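import Literature.AlgebraicGeometry.Kloosterman2025.LinearSectionHilbertFunctions
import HarnessLib

/-!
# Kloosterman 2025, §6: rational instances of the Artinian reduction for `k = 2, 3, 4` (cubic four/six/eightfolds —
# the census cells `(4,3,−1)`, `(6,3,0)`, `(8,3,1)`), and the homogeneity of Kloosterman's substituted forms

R. Kloosterman, *On a conjecture on Hodge loci of linear combinations of linear subvarieties*, Rend. Circ. Mat.
Palermo (2) 74 (2025) = arXiv:2312.12363, §6 [cite: Kloosterman2025, Prop. 6.4, Remark 6.7]:

> **Remark 6.7.** […] In this case we have a degeneration of a quartic subscheme, whereas in the above proof we used a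
> quintic subscheme. If we work with cubic fourfolds, i.e., `k = 2`, then we can always find a change of coordinates such
> that `L₂₅ = 0`. In this case it is well-known that a general threefold on `𝒟_8` […] contains a quartic and a quintic
> scroll and that they degenerate to a cubic fourfold with two disjoint planes.

The tree's `LinearSectionHilbertFunctions.lean` proves the general-fibre Hilbert functions of Prop. 6.4 / Remark 6.7 for
every `k ≥ 2` under ONE Artinian reduction (`k + 1` linear forms `y` with `h_{S/(I + (x_T) + (y))} ≤ (1,3,1)` resp.
`(1,3)`), a Zariski-open condition whose non-vacuity was so far only checked numerically. THIS FILE (cell pub-hlocus,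
honest framing: certified instances and evidence bearing on the general Hodge conjecture; no claim):

* `plueckerSubst_isHomogeneous`, `scrollSubst_isHomogeneous` — the hypothesis `hL` of all the tree's Prop. 6.4 /
  Remark 6.7 fibre theorems (the ten / eight substituted forms are linear) from the linearity of the `L_{ij}`;
* **`remark_6_7_hilbert_fibre_cubicFourfold_instance`** — `k = 2`, `L₀₅ = x₅`, `L₁₅ = x₁ + x₅`, `L₂₃ = x₅`,
  `L₂₄ = x₂ + x₄`, `t = 1` over any field: the `2 × 2` minors of `A_t` have Hilbert function `χ₃ + 3χ₃(·−1)`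
  (`(1 + 3s)/(1 − s)³`: a quartic surface scroll in `ℙ⁵`), UNCONDITIONALLY — the reduction `y = (x₀, x₂, x₃)` is
  checked by six quadratic identities (`x₁², x₁x₄, x₁x₅, x₄², x₄x₅, x₅²` modulo the generators and `(x₀, x₂, x₃)`);
* **`prop_6_4_hilbert_fibre_cubicFourfold_instance`** — `k = 2`, `L₀₄ = x₄`, `L₀₅ = L₁₄ = x₀ + x₅`, `L₁₅ = L₂₄ = x₁ + x₄`,
  `L₂₅ = x₂ + x₃`, `u = 1`: `I^{(t)} = ⟨p₁, …, p₅⟩` has Hilbert function `χ₃ + 3χ₃(·−1) + χ₃(·−2)`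
  (`(1 + 3s + s²)/(1 − s)³`: a quintic surface, linear section of the cone over `G(2,5)`), UNCONDITIONALLY — the reduction
  `y = (x₃, x₄, x₅)` is checked by six quadratic identities modulo `x₀x₂` and ten cubic identities.

* **`prop_6_4_hilbert_fibre_instance_k3`** — `k = 3` (cubic sixfolds, two 3-planes through a point: cell `(6,3,0)`),
  `L₀₄ = −x₀`, `L₀₅ = x₀ − x₄`, `L₁₄ = −x₁ + x₅`, `L₁₅ = −x₂ + x₄`, `L₂₄ = x₂ + x₄`, `L₂₅ = −x₃`, `u = 1` in `ℙ⁷`: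
  `h_{I^{(t)} + (x₇)} = χ₄ + 3χ₄(·−1) + χ₄(·−2)` unconditionally (reduction `y = (x₃, x₄, x₅, x₆)`, `μ₀ = x₀²`);
* **`prop_6_4_hilbert_fibre_instance_k4`** — `k = 4` (cubic eightfolds, two 4-planes through a line: cell `(8,3,1)`),
  `L₀₄ = −x₁ + x₂`, `L₀₅ = x₁`, `L₁₄ = x₆`, `L₁₅ = x₂ + x₇`, `L₂₄ = x₁ + x₇`, `L₂₅ = x₀ − x₆`, `u = 1` in `ℙ⁹`:
  `h_{I^{(t)} + (x₈, x₉)} = χ₅ + 3χ₅(·−1) + χ₅(·−2)` unconditionally (reduction `y = (x₀, x₃, x₄, x₅, x₇)`, `μ₀ = x₁x₂`);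
* **`remark_6_7_hilbert_fibre_instance_k3`** — Remark 6.7 for `k = 3`, `L₀₅ = x₀ + x₃`, `L₁₅ = x₁ + x₃`, `L₂₃ = x₆`,
  `L₂₄ = x₀ − x₄`, `t = 1` in `ℙ⁷`: `h_{I_t + (x₇)} = χ₄ + 3χ₄(·−1)` unconditionally (reduction `y = (x₂, x₃, x₅, x₆)`,
  six quadratic identities) — the case the tree's `IntegralScrollFibres`/`ScrollDegenerationFibres` treat only under an
  independence hypothesis on the `L_{ij}`.

So the hypothesis of the theorems is satisfiable over `ℚ` for `k = 2, 3, 4` (hence, being Zariski-open, holds for the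
general fibre in each of the census dimensions); the identities were found by exact linear algebra (cell numerics
`pub-hlocus-lit-g34/sanity`, `scratch/gen_instance.py`) and are verified here by `ring`; the reduction to three surviving
coordinates is uniform (`forall_X_mul_X_mul_X_mem`, `forall_X_mul_X_sub_mem`). 0 sorry; no named facts.

## References

* [Kloosterman2025] R. Kloosterman, arXiv:2312.12363 = Rend. Circ. Mat. Palermo (2) 74 (2025), Prop. 6.4 (proof),
  Remark 6.7.
* [Stanley1978] R. P. Stanley, *Hilbert functions of graded algebras*, Adv. Math. 28 (1978) 57–83, Cor. 3.2.
-/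

noncomputable section

open MvPolynomial Module

attribute [local instance] MvPolynomial.gradedAlgebra

namespace Literature.AlgebraicGeometry.Kloosterman2025

open Literature.RingTheory.MvPolynomial Literature.RingTheory.HilbertSamuel

universe u

variable {K : Type u} [Field K]

section SubstHomogeneous

variable {n : ℕ}

open Literature.RingTheory.MvPolynomial.Pluecker in
/-- Kloosterman's ten substituted forms `(x₀, x₁, L₂₄, L₂₅, x₂, −L₁₄, −L₁₅, L₀₄, L₀₅, u·x₃)` are linear as soon as the
`L_{ij}` are (the hypothesis `hL` of the tree's Prop. 6.4 theorems). [cite: Kloosterman2025, Prop. 6.4 (proof)] -/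
theorem plueckerSubst_isHomogeneous (i₀ i₁ i₂ i₃ : Fin (n + 1)) {L₀₄ L₀₅ L₁₄ L₁₅ L₂₄ L₂₅ : MvPolynomial (Fin (n + 1)) K}
    (u : K) (h₀₄ : L₀₄.IsHomogeneous 1) (h₀₅ : L₀₅.IsHomogeneous 1) (h₁₄ : L₁₄.IsHomogeneous 1)
    (h₁₅ : L₁₅.IsHomogeneous 1) (h₂₄ : L₂₄.IsHomogeneous 1) (h₂₅ : L₂₅.IsHomogeneous 1) (s : Pair 5) :
    (plueckerSubst i₀ i₁ i₂ i₃ L₀₄ L₀₅ L₁₄ L₁₅ L₂₄ L₂₅ u s).IsHomogeneous 1 := by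
  obtain ⟨⟨i, j⟩, hij⟩ := s
  have hX : ∀ l : Fin (n + 1), (X l : MvPolynomial (Fin (n + 1)) K).IsHomogeneous 1 := fun l => isHomogeneous_X K l
  have hu : (C u * X i₃ : MvPolynomial (Fin (n + 1)) K).IsHomogeneous 1 := (hX i₃).C_mul u
  fin_cases i <;> fin_cases j <;> simp (config := {decide := true}) at hij <;>
    simp [plueckerSubst, hX, hu, h₀₄, h₀₅, h₁₄.neg, h₁₅.neg, h₂₄, h₂₅]

/-- The eight entries of `A_t = ((−L₁₅, L₀₅, x₃, x₄), (x₀, x₁, −tL₂₄, tL₂₃))` are linear as soon as the `L_{ij}` are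
(the hypothesis `hL` of the tree's Remark 6.7 theorems). [cite: Kloosterman2025, Remark 6.7] -/
theorem scrollSubst_isHomogeneous (i₀ i₁ i₃ i₄ : Fin (n + 1)) {L₀₅ L₁₅ L₂₃ L₂₄ : MvPolynomial (Fin (n + 1)) K} (t : K)
    (h₀₅ : L₀₅.IsHomogeneous 1) (h₁₅ : L₁₅.IsHomogeneous 1) (h₂₃ : L₂₃.IsHomogeneous 1) (h₂₄ : L₂₄.IsHomogeneous 1)
    (s : Fin (4 + 4)) : (scrollSubst i₀ i₁ i₃ i₄ L₀₅ L₁₅ L₂₃ L₂₄ t s).IsHomogeneous 1 := by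
  have hX : ∀ l : Fin (n + 1), (X l : MvPolynomial (Fin (n + 1)) K).IsHomogeneous 1 := fun l => isHomogeneous_X K l
  have h₂₄' : (-(C t * L₂₄) : MvPolynomial (Fin (n + 1)) K).IsHomogeneous 1 := (h₂₄.C_mul t).neg
  have h₂₃' : (C t * L₂₃ : MvPolynomial (Fin (n + 1)) K).IsHomogeneous 1 := h₂₃.C_mul t
  refine Fin.addCases (fun i => ?_) (fun i => ?_) s
  · rw [scrollSubst, Fin.append_left]
    fin_cases i <;> simp [hX, h₀₅, h₁₅.neg]
  · rw [scrollSubst, Fin.append_right]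
    fin_cases i <;> simp [hX, h₂₄', h₂₃']

end SubstHomogeneous

/-! ## Checking an Artinian reduction: forms of degree `2` / `3` from products of variables -/

section Products

variable {τ : Type*}

/-- A monomial of positive degree is a variable times a monomial of degree one less. [folklore] -/
private theorem exists_X_mul_monomial {μ : τ →₀ ℕ} {d : ℕ} (h : μ.degree = d + 1) :
    ∃ (i : τ) (ν : τ →₀ ℕ), ν.degree = d ∧ (monomial μ (1 : K)) = X i * monomial ν 1 := by
  classical
  have hμ0 : μ ≠ 0 := by
    rintro rfl
    simp at h
  obtain ⟨i, hi⟩ := Finsupp.ne_iff.mp hμ0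
  rw [Finsupp.coe_zero, Pi.zero_apply] at hi
  have hle : Finsupp.single i 1 ≤ μ := Finsupp.single_le_iff.mpr (Nat.one_le_iff_ne_zero.mpr hi)
  refine ⟨i, μ - Finsupp.single i 1, ?_, ?_⟩
  · have hd' : (μ - Finsupp.single i 1).degree + 1 = μ.degree := by
      conv_rhs => rw [← tsub_add_cancel_of_le hle]
      rw [map_add, Finsupp.degree_single]
    omega
  · conv_lhs => rw [← tsub_add_cancel_of_le hle, add_comm, monomial_single_add, pow_one]

/-- A monomial of degree `1` is a variable. [folklore] -/
private theorem exists_monomial_eq_X {ν : τ →₀ ℕ} (h : ν.degree = 1) : ∃ i : τ, (monomial ν (1 : K)) = X i := by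
  obtain ⟨i, ν', hν', e⟩ := exists_X_mul_monomial (K := K) (d := 0) (by simpa using h)
  rw [Finsupp.degree_eq_zero_iff] at hν'
  refine ⟨i, ?_⟩
  rw [e, hν', monomial_zero', C_1, mul_one]

/-- **If all products `x_i x_j` lie in `J`, so does every quadratic form.** [folklore] -/
private theorem mem_of_forall_X_mul_X_mem {J : Ideal (MvPolynomial τ K)} (h : ∀ i j : τ, (X i * X j : _) ∈ J)
    (f : MvPolynomial τ K) (hf : f.IsHomogeneous 2) : f ∈ J := by
  classical
  rw [f.as_sum]
  refine Ideal.sum_mem _ fun μ hμ => ?_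
  have hdeg : μ.degree = 1 + 1 := by
    rw [Finsupp.degree_eq_weight_one]
    exact hf (mem_support_iff.mp hμ)
  obtain ⟨i, ν, hν, e⟩ := exists_X_mul_monomial (K := K) hdeg
  obtain ⟨j, ej⟩ := exists_monomial_eq_X (K := K) hν
  rw [← mul_one (coeff μ f), ← smul_eq_mul, ← smul_monomial, e, ej]
  exact Submodule.smul_of_tower_mem J _ (h i j)

/-- **If all products `x_i x_j x_l` lie in `J`, so does every cubic form.** [folklore] -/
private theorem mem_of_forall_X_mul_X_mul_X_mem {J : Ideal (MvPolynomial τ K)}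
    (h : ∀ i j l : τ, (X i * X j * X l : _) ∈ J) (f : MvPolynomial τ K) (hf : f.IsHomogeneous 3) : f ∈ J := by
  classical
  rw [f.as_sum]
  refine Ideal.sum_mem _ fun μ hμ => ?_
  have hdeg : μ.degree = 2 + 1 := by
    rw [Finsupp.degree_eq_weight_one]
    exact hf (mem_support_iff.mp hμ)
  obtain ⟨i, ν, hν, e⟩ := exists_X_mul_monomial (K := K) hdeg
  obtain ⟨j, ν', hν', e'⟩ := exists_X_mul_monomial (K := K) (d := 1) hν
  obtain ⟨l, el⟩ := exists_monomial_eq_X (K := K) hν'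
  rw [← mul_one (coeff μ f), ← smul_eq_mul, ← smul_monomial, e, e', el, ← mul_assoc]
  exact Submodule.smul_of_tower_mem J _ (h i j l)

/-- If `c` distinct variables lie in `J ⊆ K[x_0, …, x_{N−1}]`, then `H(S/J)(1) ≤ N − c`. [folklore] -/
private theorem hilbert_one_le_of_X_mem {N c : ℕ} {J : Ideal (MvPolynomial (Fin N) K)} (e : Fin c → Fin N)
    (he : Function.Injective e) (hJ : ∀ i, (X (e i) : MvPolynomial (Fin N) K) ∈ J) :
    finrank K (homogeneousSubmodule (Fin N) K 1) - finrank K (idealDegree J 1) ≤ N - c := by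
  have hS : finrank K (homogeneousSubmodule (Fin N) K 1) = N := by
    rw [finrank_homogeneousSubmodule_fin]
    simp
  have hli : LinearIndependent K (fun i => (X (e i) : MvPolynomial (Fin N) K)) :=
    (MvPolynomial.linearIndependent_X (σ := Fin N) (R := K)).comp e he
  have hle : Submodule.span K (Set.range fun i => (X (e i) : MvPolynomial (Fin N) K)) ≤ idealDegree J 1 := by
    rw [Submodule.span_le]
    rintro _ ⟨i, rfl⟩
    exact mem_idealDegree.mpr ⟨hJ i, isHomogeneous_X K _⟩
  have h1 := Submodule.finrank_mono hle
  rw [finrank_span_eq_card hli, Fintype.card_fin] at h1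
  omega

end Products

/-! ## Reducing "all products of variables lie in `J`" to three surviving variables -/

section Survivors

variable {N : ℕ} {J : Ideal (MvPolynomial (Fin N) K)}

/-- If the variables outside `{a, b, c}` lie in `J` and the six products of `x_a, x_b, x_c` do, then all products
`x_i x_j` lie in `J`. [folklore] -/
private theorem forall_X_mul_X_mem (kill : Finset (Fin N)) (hkill : ∀ v ∈ kill, (X v : MvPolynomial (Fin N) K) ∈ J)
    (a b c : Fin N) (hcover : ∀ i : Fin N, i ∈ kill ∨ i = a ∨ i = b ∨ i = c)
    (haa : (X a * X a : MvPolynomial (Fin N) K) ∈ J) (hab : (X a * X b : MvPolynomial (Fin N) K) ∈ J)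
    (hac : (X a * X c : MvPolynomial (Fin N) K) ∈ J) (hbb : (X b * X b : MvPolynomial (Fin N) K) ∈ J)
    (hbc : (X b * X c : MvPolynomial (Fin N) K) ∈ J) (hcc : (X c * X c : MvPolynomial (Fin N) K) ∈ J)
    (i j : Fin N) : (X i * X j : MvPolynomial (Fin N) K) ∈ J := by
  rcases hcover i with hi | hi | hi | hi
  · exact J.mul_mem_right _ (hkill i hi)
  all_goals rcases hcover j with hj | hj | hj | hj
  all_goals first | exact J.mul_mem_left _ (hkill j hj) | rw [hi, hj]
  · exact haa
  · exact hab
  · exact hac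
  · rw [show (X b * X a : MvPolynomial (Fin N) K) = X a * X b by ring]; exact hab
  · exact hbb
  · exact hbc
  · rw [show (X c * X a : MvPolynomial (Fin N) K) = X a * X c by ring]; exact hac
  · rw [show (X c * X b : MvPolynomial (Fin N) K) = X b * X c by ring]; exact hbc
  · exact hcc

/-- The same modulo multiples of a fixed quadric `μ₀`. [folklore] -/
private theorem forall_X_mul_X_sub_mem (μ₀ : MvPolynomial (Fin N) K) (kill : Finset (Fin N))
    (hkill : ∀ v ∈ kill, (X v : MvPolynomial (Fin N) K) ∈ J)
    (a b c : Fin N) (hcover : ∀ i : Fin N, i ∈ kill ∨ i = a ∨ i = b ∨ i = c)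
    (haa : ∃ e : K, (X a * X a - C e * μ₀ : MvPolynomial (Fin N) K) ∈ J)
    (hab : ∃ e : K, (X a * X b - C e * μ₀ : MvPolynomial (Fin N) K) ∈ J)
    (hac : ∃ e : K, (X a * X c - C e * μ₀ : MvPolynomial (Fin N) K) ∈ J)
    (hbb : ∃ e : K, (X b * X b - C e * μ₀ : MvPolynomial (Fin N) K) ∈ J)
    (hbc : ∃ e : K, (X b * X c - C e * μ₀ : MvPolynomial (Fin N) K) ∈ J)
    (hcc : ∃ e : K, (X c * X c - C e * μ₀ : MvPolynomial (Fin N) K) ∈ J)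
    (i j : Fin N) : ∃ e : K, (X i * X j - C e * μ₀ : MvPolynomial (Fin N) K) ∈ J := by
  have kl : ∀ p : MvPolynomial (Fin N) K, p ∈ J → ∃ e : K, p - C e * μ₀ ∈ J := fun p hp => ⟨0, by simpa using hp⟩
  rcases hcover i with hi | hi | hi | hi
  · exact kl _ (J.mul_mem_right _ (hkill i hi))
  all_goals rcases hcover j with hj | hj | hj | hj
  all_goals first | exact kl _ (J.mul_mem_left _ (hkill j hj)) | rw [hi, hj]
  · exact haa
  · exact hab
  · exact hac
  · rw [show (X b * X a : MvPolynomial (Fin N) K) = X a * X b by ring]; exact hab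
  · exact hbb
  · exact hbc
  · rw [show (X c * X a : MvPolynomial (Fin N) K) = X a * X c by ring]; exact hac
  · rw [show (X c * X b : MvPolynomial (Fin N) K) = X b * X c by ring]; exact hbc
  · exact hcc

/-- If the variables outside `{a, b, c}` lie in `J` and the ten cubic monomials in `x_a, x_b, x_c` do, then all
products `x_i x_j x_l` lie in `J`. [folklore] -/
private theorem forall_X_mul_X_mul_X_mem (kill : Finset (Fin N))
    (hkill : ∀ v ∈ kill, (X v : MvPolynomial (Fin N) K) ∈ J)
    (a b c : Fin N) (hcover : ∀ i : Fin N, i ∈ kill ∨ i = a ∨ i = b ∨ i = c)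
    (haaa : (X a * X a * X a : MvPolynomial (Fin N) K) ∈ J)
    (haab : (X a * X a * X b : MvPolynomial (Fin N) K) ∈ J)
    (haac : (X a * X a * X c : MvPolynomial (Fin N) K) ∈ J)
    (habb : (X a * X b * X b : MvPolynomial (Fin N) K) ∈ J)
    (habc : (X a * X b * X c : MvPolynomial (Fin N) K) ∈ J)
    (hacc : (X a * X c * X c : MvPolynomial (Fin N) K) ∈ J)
    (hbbb : (X b * X b * X b : MvPolynomial (Fin N) K) ∈ J)
    (hbbc : (X b * X b * X c : MvPolynomial (Fin N) K) ∈ J)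
    (hbcc : (X b * X c * X c : MvPolynomial (Fin N) K) ∈ J)
    (hccc : (X c * X c * X c : MvPolynomial (Fin N) K) ∈ J)
    (i j l : Fin N) : (X i * X j * X l : MvPolynomial (Fin N) K) ∈ J := by
  rcases hcover i with hi | hi | hi | hi
  · exact J.mul_mem_right _ (J.mul_mem_right _ (hkill i hi))
  all_goals rcases hcover j with hj | hj | hj | hj
  all_goals first | exact J.mul_mem_right _ (J.mul_mem_left _ (hkill j hj)) | skip
  all_goals rcases hcover l with hl | hl | hl | hl
  all_goals first | exact J.mul_mem_left _ (hkill l hl) | rw [hi, hj, hl]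
  · exact haaa
  · exact haab
  · exact haac
  · rw [show (X a * X b * X a : MvPolynomial (Fin N) K) = X a * X a * X b by ring]; exact haab
  · exact habb
  · exact habc
  · rw [show (X a * X c * X a : MvPolynomial (Fin N) K) = X a * X a * X c by ring]; exact haac
  · rw [show (X a * X c * X b : MvPolynomial (Fin N) K) = X a * X b * X c by ring]; exact habc
  · exact hacc
  · rw [show (X b * X a * X a : MvPolynomial (Fin N) K) = X a * X a * X b by ring]; exact haab
  · rw [show (X b * X a * X b : MvPolynomial (Fin N) K) = X a * X b * X b by ring]; exact habb
  · rw [show (X b * X a * X c : MvPolynomial (Fin N) K) = X a * X b * X c by ring]; exact habc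
  · rw [show (X b * X b * X a : MvPolynomial (Fin N) K) = X a * X b * X b by ring]; exact habb
  · exact hbbb
  · exact hbbc
  · rw [show (X b * X c * X a : MvPolynomial (Fin N) K) = X a * X b * X c by ring]; exact habc
  · rw [show (X b * X c * X b : MvPolynomial (Fin N) K) = X b * X b * X c by ring]; exact hbbc
  · exact hbcc
  · rw [show (X c * X a * X a : MvPolynomial (Fin N) K) = X a * X a * X c by ring]; exact haac
  · rw [show (X c * X a * X b : MvPolynomial (Fin N) K) = X a * X b * X c by ring]; exact habc
  · rw [show (X c * X a * X c : MvPolynomial (Fin N) K) = X a * X c * X c by ring]; exact hacc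
  · rw [show (X c * X b * X a : MvPolynomial (Fin N) K) = X a * X b * X c by ring]; exact habc
  · rw [show (X c * X b * X b : MvPolynomial (Fin N) K) = X b * X b * X c by ring]; exact hbbc
  · rw [show (X c * X b * X c : MvPolynomial (Fin N) K) = X b * X c * X c by ring]; exact hbcc
  · rw [show (X c * X c * X a : MvPolynomial (Fin N) K) = X a * X c * X c by ring]; exact hacc
  · rw [show (X c * X c * X b : MvPolynomial (Fin N) K) = X b * X c * X c by ring]; exact hbcc
  · exact hccc

end Survivors

/-! ## Remark 6.7 for cubic fourfolds (`k = 2`): a rational instance of the reduction hypothesis -/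

section Rem67Instance

local notation "𝓗₂(" I ", " m ")" =>
  (((finrank K (homogeneousSubmodule (Fin (2 * 2 + 2)) K m) - finrank K (idealDegree I m) : ℕ) : ℤ))

/-- The instance: `L₀₅ = x₅`, `L₁₅ = x₁ + x₅`, `L₂₃ = x₅`, `L₂₄ = x₂ + x₄`, `t = 1` in `ℙ⁵`; reduction `y = (x₀, x₂, x₃)`. [folklore] -/
private def remY : Fin 3 → MvPolynomial (Fin (2 * 2 + 2)) K := fun j => X (![0, 2, 3] j)

/-- The instance ideal `C = I_1 + (x₀, x₂, x₃)` (tail empty for `k = 2`). [folklore] -/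
private def remC : Ideal (MvPolynomial (Fin (2 * 2 + 2)) K) :=
  scrollFibreIdeal (tailVars 2 (2 + 4)) ⟨0, by omega⟩ ⟨1, by omega⟩ ⟨3, by omega⟩ ⟨4, by omega⟩
      (X 5) (X 1 + X 5) (X 5) (X 2 + X 4) 1 ⊔ Ideal.span (Set.range remY)

/-- Instance plumbing. [folklore] -/
private theorem remC_X_mem (j : Fin 3) : (X (![0, 2, 3] j) : MvPolynomial (Fin (2 * 2 + 2)) K) ∈ remC :=
  Ideal.mem_sup_right (Ideal.subset_span ⟨j, rfl⟩)

/-- Instance plumbing. [folklore] -/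
private theorem remC_X0 : (X 0 : MvPolynomial (Fin (2 * 2 + 2)) K) ∈ remC := remC_X_mem 0
/-- Instance plumbing. [folklore] -/
private theorem remC_X2 : (X 2 : MvPolynomial (Fin (2 * 2 + 2)) K) ∈ remC := remC_X_mem 1
/-- Instance plumbing. [folklore] -/
private theorem remC_X3 : (X 3 : MvPolynomial (Fin (2 * 2 + 2)) K) ∈ remC := remC_X_mem 2

/-- The six printed generators of `I_1` for this instance lie in `C`. [folklore] -/
private theorem remC_gens :
    (X 0 * X 3 - C 1 * (X 2 + X 4) * (X 1 + X 5) : MvPolynomial (Fin (2 * 2 + 2)) K) ∈ remC ∧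
    (X 0 * X 4 + C 1 * (X 1 + X 5) * X 5 : MvPolynomial (Fin (2 * 2 + 2)) K) ∈ remC ∧
    (X 1 * X 3 + C 1 * (X 2 + X 4) * X 5 : MvPolynomial (Fin (2 * 2 + 2)) K) ∈ remC ∧
    (X 1 * X 4 - C 1 * X 5 * X 5 : MvPolynomial (Fin (2 * 2 + 2)) K) ∈ remC ∧
    (X 0 * X 5 + X 1 * (X 1 + X 5) : MvPolynomial (Fin (2 * 2 + 2)) K) ∈ remC ∧
    (C 1 * (X 3 * X 5 + X 4 * (X 2 + X 4)) : MvPolynomial (Fin (2 * 2 + 2)) K) ∈ remC := by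
  have h : ∀ g ∈ ({X ⟨0, by omega⟩ * X ⟨3, by omega⟩ - C 1 * (X 2 + X 4) * (X 1 + X 5),
      X ⟨0, by omega⟩ * X ⟨4, by omega⟩ + C 1 * (X 1 + X 5) * X 5,
      X ⟨1, by omega⟩ * X ⟨3, by omega⟩ + C 1 * (X 2 + X 4) * X 5,
      X ⟨1, by omega⟩ * X ⟨4, by omega⟩ - C 1 * X 5 * X 5,
      X ⟨0, by omega⟩ * X 5 + X ⟨1, by omega⟩ * (X 1 + X 5),
      C 1 * (X ⟨3, by omega⟩ * X 5 + X ⟨4, by omega⟩ * (X 2 + X 4))} : Set (MvPolynomial (Fin (2 * 2 + 2)) K)),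
      g ∈ (remC : Ideal (MvPolynomial (Fin (2 * 2 + 2)) K)) := by
    intro g hg
    refine Ideal.mem_sup_left ?_
    rw [scrollFibreIdeal_eq_span]
    exact Ideal.mem_sup_left (Ideal.subset_span hg)
  refine ⟨h _ (by simp), h _ (by simp), h _ (by simp), h _ (by simp), h _ (by simp), h _ (by simp)⟩

end Rem67Instance

section Rem67InstanceCert

local notation "𝓗₂(" I ", " m ")" =>
  (((finrank K (homogeneousSubmodule (Fin (2 * 2 + 2)) K m) - finrank K (idealDegree I m) : ℕ) : ℤ))

/-- `x₁² ∈ C`. [folklore] -/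
private theorem remC_11 : (X 1 * X 1 : MvPolynomial (Fin (2 * 2 + 2)) K) ∈ remC := by
  obtain ⟨h1, h2, h3, h4, h5, -⟩ := remC_gens (K := K)
  have e : (X 1 * X 1 : MvPolynomial (Fin (2 * 2 + 2)) K) =
      (-(X 0 * X 3 - C 1 * (X 2 + X 4) * (X 1 + X 5)) - (X 0 * X 4 + C 1 * (X 1 + X 5) * X 5)
        - (X 1 * X 3 + C 1 * (X 2 + X 4) * X 5) - (X 1 * X 4 - C 1 * X 5 * X 5) + (X 0 * X 5 + X 1 * (X 1 + X 5)))
      + (X 0 * (X 3 + X 4 - X 5) + X 2 * (-X 1) + X 3 * X 1) := by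
    simp only [map_one, one_mul]; ring
  rw [e]
  exact Ideal.add_mem _ (Ideal.add_mem _ (Ideal.sub_mem _ (Ideal.sub_mem _ (Ideal.sub_mem _ (Submodule.neg_mem _ h1)
    h2) h3) h4) h5) (Ideal.add_mem _ (Ideal.add_mem _ (Ideal.mul_mem_right _ _ remC_X0)
    (Ideal.mul_mem_right _ _ remC_X2)) (Ideal.mul_mem_right _ _ remC_X3))

/-- `x₁x₄ ∈ C`. [folklore] -/
private theorem remC_14 : (X 1 * X 4 : MvPolynomial (Fin (2 * 2 + 2)) K) ∈ remC := by
  obtain ⟨h1, -, h3, -, -, -⟩ := remC_gens (K := K)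
  have e : (X 1 * X 4 : MvPolynomial (Fin (2 * 2 + 2)) K) =
      (-(X 0 * X 3 - C 1 * (X 2 + X 4) * (X 1 + X 5)) - (X 1 * X 3 + C 1 * (X 2 + X 4) * X 5))
      + (X 0 * X 3 + X 2 * (-X 1) + X 3 * X 1) := by
    simp only [map_one, one_mul]; ring
  rw [e]
  exact Ideal.add_mem _ (Ideal.sub_mem _ (Submodule.neg_mem _ h1) h3) (Ideal.add_mem _ (Ideal.add_mem _
    (Ideal.mul_mem_right _ _ remC_X0) (Ideal.mul_mem_right _ _ remC_X2)) (Ideal.mul_mem_right _ _ remC_X3))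

/-- `x₁x₅ ∈ C`. [folklore] -/
private theorem remC_15 : (X 1 * X 5 : MvPolynomial (Fin (2 * 2 + 2)) K) ∈ remC := by
  obtain ⟨h1, h2, h3, h4, -, -⟩ := remC_gens (K := K)
  have e : (X 1 * X 5 : MvPolynomial (Fin (2 * 2 + 2)) K) =
      ((X 0 * X 3 - C 1 * (X 2 + X 4) * (X 1 + X 5)) + (X 0 * X 4 + C 1 * (X 1 + X 5) * X 5)
        + (X 1 * X 3 + C 1 * (X 2 + X 4) * X 5) + (X 1 * X 4 - C 1 * X 5 * X 5))
      + (X 0 * (-X 3 - X 4) + X 2 * X 1 + X 3 * (-X 1)) := by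
    simp only [map_one, one_mul]; ring
  rw [e]
  exact Ideal.add_mem _ (Ideal.add_mem _ (Ideal.add_mem _ (Ideal.add_mem _ h1 h2) h3) h4) (Ideal.add_mem _
    (Ideal.add_mem _ (Ideal.mul_mem_right _ _ remC_X0) (Ideal.mul_mem_right _ _ remC_X2))
    (Ideal.mul_mem_right _ _ remC_X3))

/-- `x₄² ∈ C`. [folklore] -/
private theorem remC_44 : (X 4 * X 4 : MvPolynomial (Fin (2 * 2 + 2)) K) ∈ remC := by
  obtain ⟨-, -, -, -, -, h6⟩ := remC_gens (K := K)
  have e : (X 4 * X 4 : MvPolynomial (Fin (2 * 2 + 2)) K) =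
      C 1 * (X 3 * X 5 + X 4 * (X 2 + X 4)) + (X 2 * (-X 4) + X 3 * (-X 5)) := by
    simp only [map_one, one_mul]; ring
  rw [e]
  exact Ideal.add_mem _ h6 (Ideal.add_mem _ (Ideal.mul_mem_right _ _ remC_X2) (Ideal.mul_mem_right _ _ remC_X3))

/-- `x₄x₅ ∈ C`. [folklore] -/
private theorem remC_45 : (X 4 * X 5 : MvPolynomial (Fin (2 * 2 + 2)) K) ∈ remC := by
  obtain ⟨-, -, h3, -, -, -⟩ := remC_gens (K := K)
  have e : (X 4 * X 5 : MvPolynomial (Fin (2 * 2 + 2)) K) =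
      (X 1 * X 3 + C 1 * (X 2 + X 4) * X 5) + (X 2 * (-X 5) + X 3 * (-X 1)) := by
    simp only [map_one, one_mul]; ring
  rw [e]
  exact Ideal.add_mem _ h3 (Ideal.add_mem _ (Ideal.mul_mem_right _ _ remC_X2) (Ideal.mul_mem_right _ _ remC_X3))

/-- `x₅² ∈ C`. [folklore] -/
private theorem remC_55 : (X 5 * X 5 : MvPolynomial (Fin (2 * 2 + 2)) K) ∈ remC := by
  obtain ⟨h1, -, h3, h4, -, -⟩ := remC_gens (K := K)
  have e : (X 5 * X 5 : MvPolynomial (Fin (2 * 2 + 2)) K) =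
      (-(X 0 * X 3 - C 1 * (X 2 + X 4) * (X 1 + X 5)) - (X 1 * X 3 + C 1 * (X 2 + X 4) * X 5)
        - (X 1 * X 4 - C 1 * X 5 * X 5))
      + (X 0 * X 3 + X 2 * (-X 1) + X 3 * X 1) := by
    simp only [map_one, one_mul]; ring
  rw [e]
  exact Ideal.add_mem _ (Ideal.sub_mem _ (Ideal.sub_mem _ (Submodule.neg_mem _ h1) h3) h4) (Ideal.add_mem _
    (Ideal.add_mem _ (Ideal.mul_mem_right _ _ remC_X0) (Ideal.mul_mem_right _ _ remC_X2))
    (Ideal.mul_mem_right _ _ remC_X3))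

/-- All products of two variables lie in `C`. [folklore] -/
private theorem remC_X_mul_X (i j : Fin (2 * 2 + 2)) : (X i * X j : MvPolynomial (Fin (2 * 2 + 2)) K) ∈ remC := by
  refine forall_X_mul_X_mem ({0, 2, 3} : Finset (Fin (2 * 2 + 2))) (fun v hv => ?_) 1 4 5 (by decide)
    remC_11 remC_14 remC_15 remC_44 remC_45 remC_55 i j
  simp only [Finset.mem_insert, Finset.mem_singleton] at hv
  rcases hv with rfl | rfl | rfl
  exacts [remC_X0, remC_X2, remC_X3]

/-- **(H) for the instance, degree 2**: every quadric lies in `C`. [folklore] -/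
private theorem remC_h₂ (f : MvPolynomial (Fin (2 * 2 + 2)) K) (hf : f.IsHomogeneous 2) : f ∈ remC :=
  mem_of_forall_X_mul_X_mem remC_X_mul_X f hf

/-- **(H) for the instance, degree 1**: `H(S/C)(1) ≤ 3`. [folklore] -/
private theorem remC_h₁ :
    finrank K (homogeneousSubmodule (Fin (2 * 2 + 2)) K 1) - finrank K (idealDegree (remC (K := K)) 1) ≤ 3 := by
  have h := hilbert_one_le_of_X_mem (J := remC (K := K)) (![0, 2, 3] : Fin 3 → Fin (2 * 2 + 2)) (by decide) remC_X_mem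
  omega

open Literature.AlgebraicGeometry.Kloosterman2023 in
/-- **Remark 6.7 for cubic fourfolds (`k = 2`), an unconditional rational instance**: for `L₀₅ = x₅`, `L₁₅ = x₁ + x₅`,
`L₂₃ = x₅`, `L₂₄ = x₂ + x₄`, `t = 1` in `ℙ⁵` (two relations among the eight entries of `A_t`), the ideal of `2 × 2` minors
of `A_t` has Hilbert function `χ₃(m) + 3χ₃(m−1)` — Hilbert series `(1 + 3s)/(1 − s)³`, a quartic surface scroll in `ℙ⁵`
("if we work with cubic fourfolds, i.e., `k = 2` […] a quartic […] scroll"): the reduction hypothesis of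
`remark_6_7_hilbert_fibre_of_reduction` is checked with `y = (x₀, x₂, x₃)` by six explicit quadratic identities.
[cite: Kloosterman2025, Remark 6.7] -/
theorem remark_6_7_hilbert_fibre_cubicFourfold_instance (m : ℕ) :
    𝓗₂(scrollFibreIdeal (tailVars 2 (2 + 4)) ⟨0, by omega⟩ ⟨1, by omega⟩ ⟨3, by omega⟩ ⟨4, by omega⟩
        (X 5) (X 1 + X 5) (X 5) (X 2 + X 4) (1 : K), m) = chi 3 m + 3 * chi 3 ((m : ℤ) - 1) :=
  remark_6_7_hilbert_fibre_of_reduction (k := 2) le_rfl (X 5) (X 1 + X 5) (X 5) (X 2 + X 4) 1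
    (scrollSubst_isHomogeneous _ _ _ _ (1 : K) (isHomogeneous_X K 5) ((isHomogeneous_X K 1).add (isHomogeneous_X K 5))
      (isHomogeneous_X K 5) ((isHomogeneous_X K 2).add (isHomogeneous_X K 4)))
    remY (fun _ => isHomogeneous_X K _) remC_h₁ remC_h₂ m


/-- **The Artinian reduction `(H)` holds at the `k = 2` instance of Remark 6.7**: for the instance forms and
`y = (x0, x2, x3)`, the ideal `C = I_t + (x_T) + (y)` has `H(S/C)(1) ≤ 3` and contains every quadric — the
hypotheses `h₁, h₂` of `remark_6_7_hilbert_fibre_of_reduction`, exported for the general-fibre theorem.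
[cite: Kloosterman2025, Remark 6.7] -/
theorem remark_6_7_reduction_cubicFourfold_instance :
    (finrank K (homogeneousSubmodule (Fin (2 * 2 + 2)) K 1) - finrank K (idealDegree
      (scrollFibreIdeal (tailVars 2 (2 + 4)) ⟨0, by omega⟩ ⟨1, by omega⟩ ⟨3, by omega⟩ ⟨4, by omega⟩
          (X 5) (X 1 + X 5) (X 5) (X 2 + X 4) (1 : K) ⊔
        Ideal.span (Set.range fun j : Fin (2 + 1) => (X (![0, 2, 3] j) : MvPolynomial (Fin (2 * 2 + 2)) K))) 1) ≤ 3) ∧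
    (∀ f : MvPolynomial (Fin (2 * 2 + 2)) K, f.IsHomogeneous 2 → f ∈
      scrollFibreIdeal (tailVars 2 (2 + 4)) ⟨0, by omega⟩ ⟨1, by omega⟩ ⟨3, by omega⟩ ⟨4, by omega⟩
          (X 5) (X 1 + X 5) (X 5) (X 2 + X 4) (1 : K) ⊔
        Ideal.span (Set.range fun j : Fin (2 + 1) => (X (![0, 2, 3] j) : MvPolynomial (Fin (2 * 2 + 2)) K))) :=
  ⟨remC_h₁, remC_h₂⟩

end Rem67InstanceCert

/-! ## Proposition 6.4 for cubic fourfolds (`k = 2`): a rational instance of the reduction hypothesis -/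

section Prop64Instance

local notation "𝓗₂(" I ", " m ")" =>
  (((finrank K (homogeneousSubmodule (Fin (2 * 2 + 2)) K m) - finrank K (idealDegree I m) : ℕ) : ℤ))

/-- If every product `x_i x_j` is, up to a multiple of one fixed quadric `μ₀`, in `J`, then `H(S/J)(2) ≤ 1`
(`S_2 ⊆ J_2 + K μ₀`). [folklore] -/
private theorem hilbert_two_le_one_of_forall {N : ℕ} {J : Ideal (MvPolynomial (Fin N) K)}
    (μ₀ : MvPolynomial (Fin N) K) (hμ₀ : μ₀.IsHomogeneous 2)
    (h : ∀ i j : Fin N, ∃ c : K, X i * X j - C c * μ₀ ∈ J) :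
    finrank K (homogeneousSubmodule (Fin N) K 2) - finrank K (idealDegree J 2) ≤ 1 := by
  classical
  have hle : homogeneousSubmodule (Fin N) K 2 ≤ idealDegree J 2 ⊔ K ∙ μ₀ := by
    intro f hf
    rw [mem_homogeneousSubmodule] at hf
    rw [f.as_sum]
    refine Submodule.sum_mem _ fun μ hμ => ?_
    have hdeg : μ.degree = 1 + 1 := by
      rw [Finsupp.degree_eq_weight_one]
      exact hf (mem_support_iff.mp hμ)
    obtain ⟨i, ν, hν, e⟩ := exists_X_mul_monomial (K := K) hdeg
    obtain ⟨j, ej⟩ := exists_monomial_eq_X (K := K) hν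
    rw [← mul_one (coeff μ f), ← smul_eq_mul, ← smul_monomial, e, ej]
    refine Submodule.smul_mem _ _ ?_
    obtain ⟨c, hc⟩ := h i j
    have hsplit : (X i * X j : MvPolynomial (Fin N) K) = (X i * X j - C c * μ₀) + c • μ₀ := by
      rw [smul_eq_C_mul]; ring
    rw [hsplit]
    exact Submodule.add_mem_sup (mem_idealDegree.mpr ⟨hc,
      ((isHomogeneous_X K i).mul (isHomogeneous_X K j)).sub (hμ₀.C_mul c)⟩)
      (Submodule.smul_mem _ c (Submodule.mem_span_singleton_self μ₀))
  have h1 : finrank K (homogeneousSubmodule (Fin N) K 2) ≤ finrank K ↥(idealDegree J 2 ⊔ K ∙ μ₀) :=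
    Submodule.finrank_mono hle
  have h2 := Submodule.finrank_add_le_finrank_add_finrank (idealDegree J 2) (K ∙ μ₀)
  have h3 : finrank K (K ∙ μ₀) ≤ 1 := (finrank_span_le_card ({μ₀} : Set (MvPolynomial (Fin N) K))).trans (by simp)
  omega

/-- The instance: `L₀₄ = x₄`, `L₀₅ = L₁₄ = x₀ + x₅`, `L₁₅ = L₂₄ = x₁ + x₄`, `L₂₅ = x₂ + x₃`, `u = 1` in `ℙ⁵`; reduction
`y = (x₃, x₄, x₅)`. [folklore] -/
private def propY : Fin 3 → MvPolynomial (Fin (2 * 2 + 2)) K := fun j => X (![3, 4, 5] j)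

/-- The instance ideal `C = I^{(1)} + (x₃, x₄, x₅)` (tail empty for `k = 2`). [folklore] -/
private abbrev propC : Ideal (MvPolynomial (Fin (2 * 2 + 2)) K) :=
  pluckerIdeal (X ⟨0, by omega⟩) (X ⟨1, by omega⟩) (X ⟨2, by omega⟩) (X ⟨3, by omega⟩)
      (X 4) (X 0 + X 5) (X 0 + X 5) (X 1 + X 4) (X 1 + X 4) (X 2 + X 3) (C 1) ⊔
    Ideal.span (X '' (tailVars 2 (2 + 4) : Set (Fin (2 * 2 + 2)))) ⊔ Ideal.span (Set.range propY)

/-- A combination of the five substituted Plücker quadrics of the instance. [folklore] -/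
private def propComb (r₁ r₂ r₃ r₄ r₅ : MvPolynomial (Fin (2 * 2 + 2)) K) : MvPolynomial (Fin (2 * 2 + 2)) K :=
  r₁ * plucker₁ (X 0) (X 1) (X 1 + X 4) (X 2) (-(X 0 + X 5)) (X 4) +
    r₂ * plucker₂ (X 0) (X 1) (X 2 + X 3) (X 2) (-(X 1 + X 4)) (X 0 + X 5) +
    r₃ * plucker₃ (X 0) (X 1 + X 4) (X 2 + X 3) (-(X 0 + X 5)) (-(X 1 + X 4)) (C 1 * X 3) +
    r₄ * plucker₄ (X 1) (X 1 + X 4) (X 2 + X 3) (X 4) (X 0 + X 5) (C 1 * X 3) +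
    r₅ * plucker₅ (X 2) (-(X 0 + X 5)) (-(X 1 + X 4)) (X 4) (X 0 + X 5) (C 1 * X 3)

/-- Combinations of the generators lie in `C`. [folklore] -/
private theorem propComb_mem (r₁ r₂ r₃ r₄ r₅ : MvPolynomial (Fin (2 * 2 + 2)) K) :
    propComb r₁ r₂ r₃ r₄ r₅ ∈ (propC : Ideal (MvPolynomial (Fin (2 * 2 + 2)) K)) := by
  have h : ∀ g ∈ ({plucker₁ (X 0) (X 1) (X 1 + X 4) (X 2) (-(X 0 + X 5)) (X 4),
      plucker₂ (X 0) (X 1) (X 2 + X 3) (X 2) (-(X 1 + X 4)) (X 0 + X 5),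
      plucker₃ (X 0) (X 1 + X 4) (X 2 + X 3) (-(X 0 + X 5)) (-(X 1 + X 4)) (C 1 * X 3),
      plucker₄ (X 1) (X 1 + X 4) (X 2 + X 3) (X 4) (X 0 + X 5) (C 1 * X 3),
      plucker₅ (X 2) (-(X 0 + X 5)) (-(X 1 + X 4)) (X 4) (X 0 + X 5) (C 1 * X 3)} :
      Set (MvPolynomial (Fin (2 * 2 + 2)) K)), g ∈ (propC : Ideal (MvPolynomial (Fin (2 * 2 + 2)) K)) :=
    fun g hg => Ideal.mem_sup_left (Ideal.mem_sup_left (Ideal.subset_span hg))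
  unfold propComb
  refine Ideal.add_mem _ (Ideal.add_mem _ (Ideal.add_mem _ (Ideal.add_mem _ ?_ ?_) ?_) ?_) ?_
  all_goals exact Ideal.mul_mem_left _ _ (h _ (by simp))

/-- Instance plumbing. [folklore] -/
private theorem propC_X_mem (j : Fin 3) : (X (![3, 4, 5] j) : MvPolynomial (Fin (2 * 2 + 2)) K) ∈ propC :=
  Ideal.mem_sup_right (Ideal.subset_span ⟨j, rfl⟩)

/-- Instance plumbing. [folklore] -/
private theorem propC_X3 : (X 3 : MvPolynomial (Fin (2 * 2 + 2)) K) ∈ propC := propC_X_mem 0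
/-- Instance plumbing. [folklore] -/
private theorem propC_X4 : (X 4 : MvPolynomial (Fin (2 * 2 + 2)) K) ∈ propC := propC_X_mem 1
/-- Instance plumbing. [folklore] -/
private theorem propC_X5 : (X 5 : MvPolynomial (Fin (2 * 2 + 2)) K) ∈ propC := propC_X_mem 2

/-- Multiples of the killed variables lie in `C`. [folklore] -/
private theorem propC_killed (b₃ b₄ b₅ : MvPolynomial (Fin (2 * 2 + 2)) K) :
    X 3 * b₃ + X 4 * b₄ + X 5 * b₅ ∈ (propC : Ideal (MvPolynomial (Fin (2 * 2 + 2)) K)) :=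
  Ideal.add_mem _ (Ideal.add_mem _ (Ideal.mul_mem_right _ _ propC_X3) (Ideal.mul_mem_right _ _ propC_X4))
    (Ideal.mul_mem_right _ _ propC_X5)

/-- `x_0 x_0 − (0)·x₀x₂ ∈ C`. [folklore] -/
private theorem propC_q00 : (X 0 * X 0 - C (0 : K) * (X 0 * X 2) : MvPolynomial (Fin (2 * 2 + 2)) K) ∈ propC := by
  have e : (X 0 * X 0 - C (0 : K) * (X 0 * X 2) : MvPolynomial (Fin (2 * 2 + 2)) K) =
      propComb (0) (0) (0) (0) (1) +
        (X 3 * (-(X 2)) + X 4 * (X 1 + X 4) + X 5 * (-(2 * X 0) - (X 5))) := by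
    simp only [propComb, plucker₁, plucker₂, plucker₃, plucker₄, plucker₅, map_one, map_zero]; ring
  rw [e]
  exact Ideal.add_mem _ (propComb_mem _ _ _ _ _) (propC_killed _ _ _)

/-- `x_0 x_1 − (0)·x₀x₂ ∈ C`. [folklore] -/
private theorem propC_q01 : (X 0 * X 1 - C (0 : K) * (X 0 * X 2) : MvPolynomial (Fin (2 * 2 + 2)) K) ∈ propC := by
  have e : (X 0 * X 1 - C (0 : K) * (X 0 * X 2) : MvPolynomial (Fin (2 * 2 + 2)) K) =
      propComb (0) (0) (0) (-1) (0) +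
        (X 3 * (X 1 + X 4) + X 4 * (-(X 0) + X 2 - (X 5)) + X 5 * (-(X 1))) := by
    simp only [propComb, plucker₁, plucker₂, plucker₃, plucker₄, plucker₅, map_one, map_zero]; ring
  rw [e]
  exact Ideal.add_mem _ (propComb_mem _ _ _ _ _) (propC_killed _ _ _)

/-- `x_0 x_2 − (1)·x₀x₂ ∈ C`. [folklore] -/
private theorem propC_q02 : (X 0 * X 2 - C (1 : K) * (X 0 * X 2) : MvPolynomial (Fin (2 * 2 + 2)) K) ∈ propC := by
  have e : (X 0 * X 2 - C (1 : K) * (X 0 * X 2) : MvPolynomial (Fin (2 * 2 + 2)) K) =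
      propComb (0) (0) (0) (0) (0) +
        (X 3 * (0) + X 4 * (0) + X 5 * (0)) := by
    simp only [propComb, plucker₁, plucker₂, plucker₃, plucker₄, plucker₅, map_one]; ring
  rw [e]
  exact Ideal.add_mem _ (propComb_mem _ _ _ _ _) (propC_killed _ _ _)

/-- `x_1 x_1 − (1)·x₀x₂ ∈ C`. [folklore] -/
private theorem propC_q11 : (X 1 * X 1 - C (1 : K) * (X 0 * X 2) : MvPolynomial (Fin (2 * 2 + 2)) K) ∈ propC := by
  have e : (X 1 * X 1 - C (1 : K) * (X 0 * X 2) : MvPolynomial (Fin (2 * 2 + 2)) K) =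
      propComb (0) (0) (1) (0) (0) +
        (X 3 * (X 5) + X 4 * (-(2 * X 1) - (X 4)) + X 5 * (X 2)) := by
    simp only [propComb, plucker₁, plucker₂, plucker₃, plucker₄, plucker₅, map_one]; ring
  rw [e]
  exact Ideal.add_mem _ (propComb_mem _ _ _ _ _) (propC_killed _ _ _)

/-- `x_1 x_2 − (0)·x₀x₂ ∈ C`. [folklore] -/
private theorem propC_q12 : (X 1 * X 2 - C (0 : K) * (X 0 * X 2) : MvPolynomial (Fin (2 * 2 + 2)) K) ∈ propC := by
  have e : (X 1 * X 2 - C (0 : K) * (X 0 * X 2) : MvPolynomial (Fin (2 * 2 + 2)) K) =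
      propComb (1) (0) (0) (1) (0) +
        (X 3 * (-(X 1) - (X 4)) + X 4 * (-(2 * X 2) + X 5) + X 5 * (0)) := by
    simp only [propComb, plucker₁, plucker₂, plucker₃, plucker₄, plucker₅, map_one, map_zero]; ring
  rw [e]
  exact Ideal.add_mem _ (propComb_mem _ _ _ _ _) (propC_killed _ _ _)

/-- `x_2 x_2 − (-1)·x₀x₂ ∈ C`. [folklore] -/
private theorem propC_q22 : (X 2 * X 2 - C (-1 : K) * (X 0 * X 2) : MvPolynomial (Fin (2 * 2 + 2)) K) ∈ propC := by
  have e : (X 2 * X 2 - C (-1 : K) * (X 0 * X 2) : MvPolynomial (Fin (2 * 2 + 2)) K) =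
      propComb (0) (1) (-1) (0) (-1) +
        (X 3 * (-(X 5)) + X 4 * (0) + X 5 * (X 0 - (X 2) + X 5)) := by
    simp only [propComb, plucker₁, plucker₂, plucker₃, plucker₄, plucker₅, map_one, map_neg]; ring
  rw [e]
  exact Ideal.add_mem _ (propComb_mem _ _ _ _ _) (propC_killed _ _ _)

/-- `x_0 x_0 x_0 ∈ C`. [folklore] -/
private theorem propC_c000 : (X 0 * X 0 * X 0 : MvPolynomial (Fin (2 * 2 + 2)) K) ∈ propC := by
  have e : (X 0 * X 0 * X 0 : MvPolynomial (Fin (2 * 2 + 2)) K) =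
      propComb (-(X 1)) (X 0) (X 2) (0) (0) +
        (X 3 * (-(X 0 * X 2) + X 2 * X 5) + X 4 * (-(X 1 * X 2) - (X 2 * X 4)) + X 5 * (-(X 0 * X 0) + X 1 * X 1 + X 2 * X 2)) := by
    simp only [propComb, plucker₁, plucker₂, plucker₃, plucker₄, plucker₅, map_one, one_mul]; ring
  rw [e]
  exact Ideal.add_mem _ (propComb_mem _ _ _ _ _) (propC_killed _ _ _)

/-- `x_0 x_0 x_1 ∈ C`. [folklore] -/
private theorem propC_c001 : (X 0 * X 0 * X 1 : MvPolynomial (Fin (2 * 2 + 2)) K) ∈ propC := by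
  have e : (X 0 * X 0 * X 1 : MvPolynomial (Fin (2 * 2 + 2)) K) =
      propComb (-(X 2)) (X 1) (-(X 1)) (0) (0) +
        (X 3 * (-(X 1 * X 2) - (X 1 * X 5)) + X 4 * (X 0 * X 2 + X 1 * X 1 + X 1 * X 4 + X 2 * X 2) + X 5 * (-(X 0 * X 1))) := by
    simp only [propComb, plucker₁, plucker₂, plucker₃, plucker₄, plucker₅, map_one, one_mul]; ring
  rw [e]
  exact Ideal.add_mem _ (propComb_mem _ _ _ _ _) (propC_killed _ _ _)

/-- `x_0 x_0 x_2 ∈ C`. [folklore] -/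
private theorem propC_c002 : (X 0 * X 0 * X 2 : MvPolynomial (Fin (2 * 2 + 2)) K) ∈ propC := by
  have e : (X 0 * X 0 * X 2 : MvPolynomial (Fin (2 * 2 + 2)) K) =
      propComb (0) (0) (-(X 0)) (-(X 1)) (0) +
        (X 3 * (-(X 0 * X 5) + X 1 * X 1 + X 1 * X 4) + X 4 * (X 0 * X 1 + X 0 * X 4 + X 1 * X 2 - (X 1 * X 5)) + X 5 * (-(X 0 * X 2) - (X 1 * X 1))) := by
    simp only [propComb, plucker₁, plucker₂, plucker₃, plucker₄, plucker₅, map_one, one_mul]; ring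
  rw [e]
  exact Ideal.add_mem _ (propComb_mem _ _ _ _ _) (propC_killed _ _ _)

/-- `x_0 x_1 x_1 ∈ C`. [folklore] -/
private theorem propC_c011 : (X 0 * X 1 * X 1 : MvPolynomial (Fin (2 * 2 + 2)) K) ∈ propC := by
  have e : (X 0 * X 1 * X 1 : MvPolynomial (Fin (2 * 2 + 2)) K) =
      propComb (0) (0) (0) (-(X 1)) (0) +
        (X 3 * (X 1 * X 1 + X 1 * X 4) + X 4 * (-(X 0 * X 1) + X 1 * X 2 - (X 1 * X 5)) + X 5 * (-(X 1 * X 1))) := by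
    simp only [propComb, plucker₁, plucker₂, plucker₃, plucker₄, plucker₅, map_one, one_mul]; ring
  rw [e]
  exact Ideal.add_mem _ (propComb_mem _ _ _ _ _) (propC_killed _ _ _)

/-- `x_0 x_1 x_2 ∈ C`. [folklore] -/
private theorem propC_c012 : (X 0 * X 1 * X 2 : MvPolynomial (Fin (2 * 2 + 2)) K) ∈ propC := by
  have e : (X 0 * X 1 * X 2 : MvPolynomial (Fin (2 * 2 + 2)) K) =
      propComb (X 0 + X 2) (-(X 1)) (X 1) (0) (0) +
        (X 3 * (X 1 * X 2 + X 1 * X 5) + X 4 * (-(X 0 * X 0) - (2 * X 0 * X 2) - (X 1 * X 1) - (X 1 * X 4) - (X 2 * X 2)) + X 5 * (0)) := by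
    simp only [propComb, plucker₁, plucker₂, plucker₃, plucker₄, plucker₅, map_one, one_mul]; ring
  rw [e]
  exact Ideal.add_mem _ (propComb_mem _ _ _ _ _) (propC_killed _ _ _)

/-- `x_0 x_2 x_2 ∈ C`. [folklore] -/
private theorem propC_c022 : (X 0 * X 2 * X 2 : MvPolynomial (Fin (2 * 2 + 2)) K) ∈ propC := by
  have e : (X 0 * X 2 * X 2 : MvPolynomial (Fin (2 * 2 + 2)) K) =
      propComb (X 1) (0) (-(X 2)) (X 1) (0) +
        (X 3 * (-(X 1 * X 1) - (X 1 * X 4) - (X 2 * X 5)) + X 4 * (X 1 * X 5 + X 2 * X 4) + X 5 * (-(X 2 * X 2))) := by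
    simp only [propComb, plucker₁, plucker₂, plucker₃, plucker₄, plucker₅, map_one, one_mul]; ring
  rw [e]
  exact Ideal.add_mem _ (propComb_mem _ _ _ _ _) (propC_killed _ _ _)

/-- `x_1 x_1 x_1 ∈ C`. [folklore] -/
private theorem propC_c111 : (X 1 * X 1 * X 1 : MvPolynomial (Fin (2 * 2 + 2)) K) ∈ propC := by
  have e : (X 1 * X 1 * X 1 : MvPolynomial (Fin (2 * 2 + 2)) K) =
      propComb (X 0 + X 2) (-(X 1)) (2 * X 1) (0) (0) +
        (X 3 * (X 1 * X 2 + 2 * X 1 * X 5) + X 4 * (-(X 0 * X 0) - (2 * X 0 * X 2) - (3 * X 1 * X 1) - (2 * X 1 * X 4) - (X 2 * X 2)) + X 5 * (X 1 * X 2)) := by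
    simp only [propComb, plucker₁, plucker₂, plucker₃, plucker₄, plucker₅, map_one, one_mul]; ring
  rw [e]
  exact Ideal.add_mem _ (propComb_mem _ _ _ _ _) (propC_killed _ _ _)

/-- `x_1 x_1 x_2 ∈ C`. [folklore] -/
private theorem propC_c112 : (X 1 * X 1 * X 2 : MvPolynomial (Fin (2 * 2 + 2)) K) ∈ propC := by
  have e : (X 1 * X 1 * X 2 : MvPolynomial (Fin (2 * 2 + 2)) K) =
      propComb (X 1) (0) (0) (X 1) (0) +
        (X 3 * (-(X 1 * X 1) - (X 1 * X 4)) + X 4 * (-(2 * X 1 * X 2) + X 1 * X 5) + X 5 * (0)) := by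
    simp only [propComb, plucker₁, plucker₂, plucker₃, plucker₄, plucker₅, map_one, one_mul]; ring
  rw [e]
  exact Ideal.add_mem _ (propComb_mem _ _ _ _ _) (propC_killed _ _ _)

/-- `x_1 x_2 x_2 ∈ C`. [folklore] -/
private theorem propC_c122 : (X 1 * X 2 * X 2 : MvPolynomial (Fin (2 * 2 + 2)) K) ∈ propC := by
  have e : (X 1 * X 2 * X 2 : MvPolynomial (Fin (2 * 2 + 2)) K) =
      propComb (-(X 0)) (X 1) (-(X 1)) (0) (0) +
        (X 3 * (-(X 1 * X 2) - (X 1 * X 5)) + X 4 * (X 0 * X 0 + X 0 * X 2 + X 1 * X 1 + X 1 * X 4) + X 5 * (-(X 1 * X 2))) := by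
    simp only [propComb, plucker₁, plucker₂, plucker₃, plucker₄, plucker₅, map_one, one_mul]; ring
  rw [e]
  exact Ideal.add_mem _ (propComb_mem _ _ _ _ _) (propC_killed _ _ _)

/-- `x_2 x_2 x_2 ∈ C`. [folklore] -/
private theorem propC_c222 : (X 2 * X 2 * X 2 : MvPolynomial (Fin (2 * 2 + 2)) K) ∈ propC := by
  have e : (X 2 * X 2 * X 2 : MvPolynomial (Fin (2 * 2 + 2)) K) =
      propComb (-(X 1)) (X 2) (X 0) (0) (0) +
        (X 3 * (X 0 * X 5 - (X 2 * X 2)) + X 4 * (-(X 0 * X 1) - (X 0 * X 4)) + X 5 * (X 1 * X 1)) := by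
    simp only [propComb, plucker₁, plucker₂, plucker₃, plucker₄, plucker₅, map_one, one_mul]; ring
  rw [e]
  exact Ideal.add_mem _ (propComb_mem _ _ _ _ _) (propC_killed _ _ _)

/-- The killed variables `x₃, x₄, x₅` lie in `C`. [folklore] -/
private theorem propC_kill : ∀ v ∈ ({3, 4, 5} : Finset (Fin (2 * 2 + 2))), (X v : MvPolynomial (Fin (2 * 2 + 2)) K) ∈ propC := by
  intro v hv
  simp only [Finset.mem_insert, Finset.mem_singleton] at hv
  rcases hv with rfl | rfl | rfl
  exacts [propC_X3, propC_X4, propC_X5]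

/-- All products of three variables lie in `C`. [folklore] -/
private theorem propC_X_mul_X_mul_X (i j l : Fin (2 * 2 + 2)) :
    (X i * X j * X l : MvPolynomial (Fin (2 * 2 + 2)) K) ∈ propC :=
  forall_X_mul_X_mul_X_mem ({3, 4, 5} : Finset (Fin (2 * 2 + 2))) propC_kill 0 1 2 (by decide)
    propC_c000 propC_c001 propC_c002 propC_c011 propC_c012 propC_c022 propC_c111 propC_c112 propC_c122 propC_c222 i j l

/-- Every product of two variables is, modulo `x₀x₂`, in `C`. [folklore] -/
private theorem propC_X_mul_X (i j : Fin (2 * 2 + 2)) :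
    ∃ c : K, (X i * X j - C c * (X 0 * X 2) : MvPolynomial (Fin (2 * 2 + 2)) K) ∈ propC :=
  forall_X_mul_X_sub_mem (X 0 * X 2) ({3, 4, 5} : Finset (Fin (2 * 2 + 2))) propC_kill 0 1 2 (by decide)
    ⟨_, propC_q00⟩ ⟨_, propC_q01⟩ ⟨_, propC_q02⟩ ⟨_, propC_q11⟩ ⟨_, propC_q12⟩ ⟨_, propC_q22⟩ i j

/-- **(H), degree 1**: `H(S/C)(1) ≤ 3`. [folklore] -/
private theorem propC_h₁ :
    finrank K (homogeneousSubmodule (Fin (2 * 2 + 2)) K 1) - finrank K (idealDegree (propC (K := K)) 1) ≤ 3 := by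
  have h := hilbert_one_le_of_X_mem (J := propC (K := K)) (![3, 4, 5] : Fin 3 → Fin (2 * 2 + 2)) (by decide)
    propC_X_mem
  omega

/-- **(H), degree 2**: `H(S/C)(2) ≤ 1`. [folklore] -/
private theorem propC_h₂ :
    finrank K (homogeneousSubmodule (Fin (2 * 2 + 2)) K 2) - finrank K (idealDegree (propC (K := K)) 2) ≤ 1 :=
  hilbert_two_le_one_of_forall (X 0 * X 2) ((isHomogeneous_X K 0).mul (isHomogeneous_X K 2)) propC_X_mul_X

/-- **(H), degree 3**: every cubic lies in `C`. [folklore] -/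
private theorem propC_h₃ (f : MvPolynomial (Fin (2 * 2 + 2)) K) (hf : f.IsHomogeneous 3) : f ∈ propC :=
  mem_of_forall_X_mul_X_mul_X_mem propC_X_mul_X_mul_X f hf

open Literature.AlgebraicGeometry.Kloosterman2023 in
/-- **Proposition 6.4 for cubic fourfolds (`k = 2`), an unconditional rational instance**: for `L₀₄ = x₄`,
`L₀₅ = L₁₄ = x₀ + x₅`, `L₁₅ = L₂₄ = x₁ + x₄`, `L₂₅ = x₂ + x₃`, `u = 1/t = 1` in `ℙ⁵` (four relations among the ten
substituted forms), `I^{(t)} = ⟨p₁, …, p₅⟩` has Hilbert function `χ₃(m) + 3χ₃(m−1) + χ₃(m−2)` — Hilbert series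
`(1 + 3s + s²)/(1 − s)³`, a quintic surface, linear section of the cone over `G(2,5)` ("we used a quintic subscheme"):
the reduction hypothesis of `prop_6_4_hilbert_fibre_of_reduction` is checked with `y = (x₃, x₄, x₅)` by sixteen explicit
identities. [cite: Kloosterman2025, Prop. 6.4 (proof), Remark 6.7] -/
theorem prop_6_4_hilbert_fibre_cubicFourfold_instance (m : ℕ) :
    𝓗₂(pluckerIdeal (X ⟨0, by omega⟩) (X ⟨1, by omega⟩) (X ⟨2, by omega⟩) (X ⟨3, by omega⟩)
        (X 4) (X 0 + X 5) (X 0 + X 5) (X 1 + X 4) (X 1 + X 4) (X 2 + X 3) (C (1 : K)) ⊔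
        Ideal.span (X '' (tailVars 2 (2 + 4) : Set (Fin (2 * 2 + 2)))), m) =
      chi 3 m + 3 * chi 3 ((m : ℤ) - 1) + chi 3 ((m : ℤ) - 2) := by
  have hL := plueckerSubst_isHomogeneous (n := 2 * 2 + 1) ⟨0, by omega⟩ ⟨1, by omega⟩ ⟨2, by omega⟩ ⟨3, by omega⟩
    (1 : K) (isHomogeneous_X K 4) ((isHomogeneous_X K 0).add (isHomogeneous_X K 5))
    ((isHomogeneous_X K 0).add (isHomogeneous_X K 5)) ((isHomogeneous_X K 1).add (isHomogeneous_X K 4))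
    ((isHomogeneous_X K 1).add (isHomogeneous_X K 4)) ((isHomogeneous_X K 2).add (isHomogeneous_X K 3))
  have h1 := propC_h₁ (K := K)
  have h2 := propC_h₂ (K := K)
  have h3 := propC_h₃ (K := K)
  have h := prop_6_4_hilbert_fibre_of_reduction (K := K) (k := 2) le_rfl (X 4) (X 0 + X 5) (X 0 + X 5) (X 1 + X 4)
    (X 1 + X 4) (X 2 + X 3) 1 hL propY (fun _ => isHomogeneous_X K _) h1 h2 h3 m
  exact h


/-- **The Artinian reduction `(H)` holds at the `k = 2` instance of Prop. 6.4** (cubic fourfolds, cell `(4,3,−1)`): for the instance forms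
and `y = (x3, x4, x5)`, the ideal `C = I^{(t)} + (x_T) + (y)` has `H(S/C)(1) ≤ 3`, `H(S/C)(2) ≤ 1` and contains
every cubic — the three hypotheses `h₁, h₂, h₃` of `prop_6_4_hilbert_fibre_of_reduction`, exported for the general-fibre
theorem (`LinearSectionGeneralFibres`). [cite: Kloosterman2025, Prop. 6.4 (proof)] -/
theorem prop_6_4_reduction_cubicFourfold_instance :
    (finrank K (homogeneousSubmodule (Fin (2 * 2 + 2)) K 1) - finrank K (idealDegree
      (pluckerIdeal (X ⟨0, by omega⟩) (X ⟨1, by omega⟩) (X ⟨2, by omega⟩) (X ⟨3, by omega⟩)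
          (X 4) (X 0 + X 5) (X 0 + X 5) (X 1 + X 4) (X 1 + X 4) (X 2 + X 3) (C (1 : K)) ⊔
        Ideal.span (X '' (tailVars 2 (2 + 4) : Set (Fin (2 * 2 + 2)))) ⊔
        Ideal.span (Set.range fun j : Fin (2 + 1) => (X (![3, 4, 5] j) : MvPolynomial (Fin (2 * 2 + 2)) K))) 1) ≤ 3) ∧
    (finrank K (homogeneousSubmodule (Fin (2 * 2 + 2)) K 2) - finrank K (idealDegree
      (pluckerIdeal (X ⟨0, by omega⟩) (X ⟨1, by omega⟩) (X ⟨2, by omega⟩) (X ⟨3, by omega⟩)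
          (X 4) (X 0 + X 5) (X 0 + X 5) (X 1 + X 4) (X 1 + X 4) (X 2 + X 3) (C (1 : K)) ⊔
        Ideal.span (X '' (tailVars 2 (2 + 4) : Set (Fin (2 * 2 + 2)))) ⊔
        Ideal.span (Set.range fun j : Fin (2 + 1) => (X (![3, 4, 5] j) : MvPolynomial (Fin (2 * 2 + 2)) K))) 2) ≤ 1) ∧
    (∀ f : MvPolynomial (Fin (2 * 2 + 2)) K, f.IsHomogeneous 3 → f ∈
      pluckerIdeal (X ⟨0, by omega⟩) (X ⟨1, by omega⟩) (X ⟨2, by omega⟩) (X ⟨3, by omega⟩)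
          (X 4) (X 0 + X 5) (X 0 + X 5) (X 1 + X 4) (X 1 + X 4) (X 2 + X 3) (C (1 : K)) ⊔
        Ideal.span (X '' (tailVars 2 (2 + 4) : Set (Fin (2 * 2 + 2)))) ⊔
        Ideal.span (Set.range fun j : Fin (2 + 1) => (X (![3, 4, 5] j) : MvPolynomial (Fin (2 * 2 + 2)) K))) :=
  ⟨propC_h₁, propC_h₂, propC_h₃⟩

end Prop64Instance

/-! ## Proposition 6.4 for `k = 3` (cubic sixfolds with two 3-planes meeting in a point (census cell `(6,3,0)`)): a rational instance of the reduction hypothesis -/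

section Prop64Instance3

local notation "𝓗_3(" I ", " m ")" =>
  (((finrank K (homogeneousSubmodule (Fin (2 * 3 + 2)) K m) - finrank K (idealDegree I m) : ℕ) : ℤ))

/-- The reduction `y` = the coordinates `x_3, x_4, x_5, x_6`. [folklore] -/
private def propY3 : Fin (3 + 1) → MvPolynomial (Fin (2 * 3 + 2)) K := fun j => X (![3, 4, 5, 6] j)

/-- The instance ideal `C = I^{(t)} + (x_T) + (y)` for `L₀₄ = -(X 0)`, `L₀₅ = X 0 - (X 4)`, `L₁₄ = -(X 1) + X 5`, `L₁₅ = -(X 2) + X 4`,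
`L₂₄ = X 2 + X 4`, `L₂₅ = -(X 3)`, `u = 1`. [folklore] -/
private abbrev propC3 : Ideal (MvPolynomial (Fin (2 * 3 + 2)) K) :=
  pluckerIdeal (X ⟨0, by omega⟩) (X ⟨1, by omega⟩) (X ⟨2, by omega⟩) (X ⟨3, by omega⟩)
      (-(X 0)) (X 0 - (X 4)) (-(X 1) + X 5) (-(X 2) + X 4) (X 2 + X 4) (-(X 3)) (C 1) ⊔
    Ideal.span (X '' (tailVars 3 (3 + 4) : Set (Fin (2 * 3 + 2)))) ⊔ Ideal.span (Set.range propY3)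

/-- A combination of the five substituted Plücker quadrics of the instance. [folklore] -/
private def propComb3 (r₁ r₂ r₃ r₄ r₅ : MvPolynomial (Fin (2 * 3 + 2)) K) : MvPolynomial (Fin (2 * 3 + 2)) K :=
  r₁ * plucker₁ (X 0) (X 1) (X 2 + X 4) (X 2) (-(-(X 1) + X 5)) (-(X 0)) +
    r₂ * plucker₂ (X 0) (X 1) (-(X 3)) (X 2) (-(-(X 2) + X 4)) (X 0 - (X 4)) +
    r₃ * plucker₃ (X 0) (X 2 + X 4) (-(X 3)) (-(-(X 1) + X 5)) (-(-(X 2) + X 4)) (C 1 * X 3) +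
    r₄ * plucker₄ (X 1) (X 2 + X 4) (-(X 3)) (-(X 0)) (X 0 - (X 4)) (C 1 * X 3) +
    r₅ * plucker₅ (X 2) (-(-(X 1) + X 5)) (-(-(X 2) + X 4)) (-(X 0)) (X 0 - (X 4)) (C 1 * X 3)

/-- Combinations of the generators lie in `C`. [folklore] -/
private theorem propComb3_mem (r₁ r₂ r₃ r₄ r₅ : MvPolynomial (Fin (2 * 3 + 2)) K) :
    propComb3 r₁ r₂ r₃ r₄ r₅ ∈ (propC3 : Ideal (MvPolynomial (Fin (2 * 3 + 2)) K)) := by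
  have h : ∀ g ∈ ({plucker₁ (X 0) (X 1) (X 2 + X 4) (X 2) (-(-(X 1) + X 5)) (-(X 0)),
      plucker₂ (X 0) (X 1) (-(X 3)) (X 2) (-(-(X 2) + X 4)) (X 0 - (X 4)),
      plucker₃ (X 0) (X 2 + X 4) (-(X 3)) (-(-(X 1) + X 5)) (-(-(X 2) + X 4)) (C 1 * X 3),
      plucker₄ (X 1) (X 2 + X 4) (-(X 3)) (-(X 0)) (X 0 - (X 4)) (C 1 * X 3),
      plucker₅ (X 2) (-(-(X 1) + X 5)) (-(-(X 2) + X 4)) (-(X 0)) (X 0 - (X 4)) (C 1 * X 3)} :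
      Set (MvPolynomial (Fin (2 * 3 + 2)) K)), g ∈ (propC3 : Ideal (MvPolynomial (Fin (2 * 3 + 2)) K)) :=
    fun g hg => Ideal.mem_sup_left (Ideal.mem_sup_left (Ideal.subset_span hg))
  unfold propComb3
  refine Ideal.add_mem _ (Ideal.add_mem _ (Ideal.add_mem _ (Ideal.add_mem _ ?_ ?_) ?_) ?_) ?_
  all_goals exact Ideal.mul_mem_left _ _ (h _ (by simp))

/-- Instance plumbing. [folklore] -/
private theorem propC3_X_mem (j : Fin (3 + 1)) : (X (![3, 4, 5, 6] j) : MvPolynomial (Fin (2 * 3 + 2)) K) ∈ propC3 :=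
  Ideal.mem_sup_right (Ideal.subset_span ⟨j, rfl⟩)

/-- Instance plumbing. [folklore] -/
private theorem propC3_X3 : (X 3 : MvPolynomial (Fin (2 * 3 + 2)) K) ∈ propC3 := propC3_X_mem 0
/-- Instance plumbing. [folklore] -/
private theorem propC3_X4 : (X 4 : MvPolynomial (Fin (2 * 3 + 2)) K) ∈ propC3 := propC3_X_mem 1
/-- Instance plumbing. [folklore] -/
private theorem propC3_X5 : (X 5 : MvPolynomial (Fin (2 * 3 + 2)) K) ∈ propC3 := propC3_X_mem 2
/-- Instance plumbing. [folklore] -/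
private theorem propC3_X6 : (X 6 : MvPolynomial (Fin (2 * 3 + 2)) K) ∈ propC3 := propC3_X_mem 3
/-- Instance plumbing. [folklore] -/
private theorem propC3_X7 : (X 7 : MvPolynomial (Fin (2 * 3 + 2)) K) ∈ propC3 :=
  Ideal.mem_sup_left (Ideal.mem_sup_right (Ideal.subset_span ⟨7, by simp [tailVars], rfl⟩))

/-- Multiples of the killed variables lie in `C`. [folklore] -/
private theorem propC3_killed (b3 b4 b5 b6 b7 : MvPolynomial (Fin (2 * 3 + 2)) K) :
    X 3 * b3 + X 4 * b4 + X 5 * b5 + X 6 * b6 + X 7 * b7 ∈ (propC3 : Ideal (MvPolynomial (Fin (2 * 3 + 2)) K)) :=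
  Ideal.add_mem _ (Ideal.add_mem _ (Ideal.add_mem _ (Ideal.add_mem _ (Ideal.mul_mem_right _ _ propC3_X3) (Ideal.mul_mem_right _ _ propC3_X4)) (Ideal.mul_mem_right _ _ propC3_X5)) (Ideal.mul_mem_right _ _ propC3_X6)) (Ideal.mul_mem_right _ _ propC3_X7)

/-- `x_0 x_0 − (1)·μ₀ ∈ C`, `μ₀ = X 0 * X 0`. [folklore] -/
private theorem propC3_q0_0 : (X 0 * X 0 - C (1 : K) * (X 0 * X 0) : MvPolynomial (Fin (2 * 3 + 2)) K) ∈ propC3 := by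
  have e : (X 0 * X 0 - C (1 : K) * (X 0 * X 0) : MvPolynomial (Fin (2 * 3 + 2)) K) =
      propComb3 (0) (0) (0) (0) (0) +
        (X 3 * (0) + X 4 * (0) + X 5 * (0) + X 6 * (0) + X 7 * (0)) := by
    simp only [propComb3, plucker₁, plucker₂, plucker₃, plucker₄, plucker₅, map_one]; ring
  rw [e]
  exact Ideal.add_mem _ (propComb3_mem _ _ _ _ _) (propC3_killed _ _ _ _ _)

/-- `x_0 x_1 − (0)·μ₀ ∈ C`, `μ₀ = X 0 * X 0`. [folklore] -/
private theorem propC3_q0_1 : (X 0 * X 1 - C (0 : K) * (X 0 * X 0) : MvPolynomial (Fin (2 * 3 + 2)) K) ∈ propC3 := by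
  have e : (X 0 * X 1 - C (0 : K) * (X 0 * X 0) : MvPolynomial (Fin (2 * 3 + 2)) K) =
      propComb3 (0) (0) (0) (1) (-1) +
        (X 3 * (-(X 0) - (X 1) + X 2) + X 4 * (2 * X 0 + X 1 - (X 2) - (X 4) - (X 5)) + X 5 * (X 0) + X 6 * (0) + X 7 * (0)) := by
    simp only [propComb3, plucker₁, plucker₂, plucker₃, plucker₄, plucker₅, map_one, map_zero]; ring
  rw [e]
  exact Ideal.add_mem _ (propComb3_mem _ _ _ _ _) (propC3_killed _ _ _ _ _)

/-- `x_0 x_2 − (0)·μ₀ ∈ C`, `μ₀ = X 0 * X 0`. [folklore] -/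
private theorem propC3_q0_2 : (X 0 * X 2 - C (0 : K) * (X 0 * X 0) : MvPolynomial (Fin (2 * 3 + 2)) K) ∈ propC3 := by
  have e : (X 0 * X 2 - C (0 : K) * (X 0 * X 0) : MvPolynomial (Fin (2 * 3 + 2)) K) =
      propComb3 (0) (0) (0) (-1) (0) +
        (X 3 * (X 0 + X 1) + X 4 * (-(X 0) + X 2 + X 4) + X 5 * (0) + X 6 * (0) + X 7 * (0)) := by
    simp only [propComb3, plucker₁, plucker₂, plucker₃, plucker₄, plucker₅, map_one, map_zero]; ring
  rw [e]
  exact Ideal.add_mem _ (propComb3_mem _ _ _ _ _) (propC3_killed _ _ _ _ _)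

/-- `x_1 x_1 − (-1)·μ₀ ∈ C`, `μ₀ = X 0 * X 0`. [folklore] -/
private theorem propC3_q1_1 : (X 1 * X 1 - C (-1 : K) * (X 0 * X 0) : MvPolynomial (Fin (2 * 3 + 2)) K) ∈ propC3 := by
  have e : (X 1 * X 1 - C (-1 : K) * (X 0 * X 0) : MvPolynomial (Fin (2 * 3 + 2)) K) =
      propComb3 (-1) (0) (-1) (0) (0) +
        (X 3 * (X 0 - (X 1) + X 5) + X 4 * (X 2 + X 4) + X 5 * (X 1) + X 6 * (0) + X 7 * (0)) := by
    simp only [propComb3, plucker₁, plucker₂, plucker₃, plucker₄, plucker₅, map_one, map_neg]; ring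
  rw [e]
  exact Ideal.add_mem _ (propComb3_mem _ _ _ _ _) (propC3_killed _ _ _ _ _)

/-- `x_1 x_2 − (1)·μ₀ ∈ C`, `μ₀ = X 0 * X 0`. [folklore] -/
private theorem propC3_q1_2 : (X 1 * X 2 - C (1 : K) * (X 0 * X 0) : MvPolynomial (Fin (2 * 3 + 2)) K) ∈ propC3 := by
  have e : (X 1 * X 2 - C (1 : K) * (X 0 * X 0) : MvPolynomial (Fin (2 * 3 + 2)) K) =
      propComb3 (0) (-1) (0) (0) (0) +
        (X 3 * (-(X 2)) + X 4 * (-(X 0) + X 1) + X 5 * (0) + X 6 * (0) + X 7 * (0)) := by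
    simp only [propComb3, plucker₁, plucker₂, plucker₃, plucker₄, plucker₅, map_one]; ring
  rw [e]
  exact Ideal.add_mem _ (propComb3_mem _ _ _ _ _) (propC3_killed _ _ _ _ _)

/-- `x_2 x_2 − (0)·μ₀ ∈ C`, `μ₀ = X 0 * X 0`. [folklore] -/
private theorem propC3_q2_2 : (X 2 * X 2 - C (0 : K) * (X 0 * X 0) : MvPolynomial (Fin (2 * 3 + 2)) K) ∈ propC3 := by
  have e : (X 2 * X 2 - C (0 : K) * (X 0 * X 0) : MvPolynomial (Fin (2 * 3 + 2)) K) =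
      propComb3 (0) (0) (-1) (0) (0) +
        (X 3 * (X 0 - (X 1) + X 5) + X 4 * (X 4) + X 5 * (0) + X 6 * (0) + X 7 * (0)) := by
    simp only [propComb3, plucker₁, plucker₂, plucker₃, plucker₄, plucker₅, map_one, map_zero]; ring
  rw [e]
  exact Ideal.add_mem _ (propComb3_mem _ _ _ _ _) (propC3_killed _ _ _ _ _)

/-- `x_0 x_0 x_0 ∈ C`. [folklore] -/
private theorem propC3_c0_0_0 : (X 0 * X 0 * X 0 : MvPolynomial (Fin (2 * 3 + 2)) K) ∈ propC3 := by
  have e : (X 0 * X 0 * X 0 : MvPolynomial (Fin (2 * 3 + 2)) K) =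
      propComb3 (0) (X 0) (0) (-(X 1)) (0) +
        (X 3 * (X 0 * X 1 + X 0 * X 2 + X 1 * X 1) + X 4 * (X 0 * X 0 - (2 * X 0 * X 1) + X 1 * X 2 + X 1 * X 4) + X 5 * (0) + X 6 * (0) + X 7 * (0)) := by
    simp only [propComb3, plucker₁, plucker₂, plucker₃, plucker₄, plucker₅, map_one]; ring
  rw [e]
  exact Ideal.add_mem _ (propComb3_mem _ _ _ _ _) (propC3_killed _ _ _ _ _)

/-- `x_0 x_0 x_1 ∈ C`. [folklore] -/
private theorem propC3_c0_0_1 : (X 0 * X 0 * X 1 : MvPolynomial (Fin (2 * 3 + 2)) K) ∈ propC3 := by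
  have e : (X 0 * X 0 * X 1 : MvPolynomial (Fin (2 * 3 + 2)) K) =
      propComb3 (-(X 2)) (X 1 - (X 2)) (X 1 - (X 2)) (0) (0) +
        (X 3 * (-(X 0 * X 1) + X 0 * X 2 + X 1 * X 1 - (X 1 * X 5) - (X 2 * X 2) + X 2 * X 5) + X 4 * (X 0 * X 1 - (X 0 * X 2) - (X 1 * X 1) + X 1 * X 2 - (X 1 * X 4) + X 2 * X 2 + X 2 * X 4) + X 5 * (X 1 * X 2) + X 6 * (0) + X 7 * (0)) := by
    simp only [propComb3, plucker₁, plucker₂, plucker₃, plucker₄, plucker₅, map_one]; ring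
  rw [e]
  exact Ideal.add_mem _ (propComb3_mem _ _ _ _ _) (propC3_killed _ _ _ _ _)

/-- `x_0 x_0 x_2 ∈ C`. [folklore] -/
private theorem propC3_c0_0_2 : (X 0 * X 0 * X 2 : MvPolynomial (Fin (2 * 3 + 2)) K) ∈ propC3 := by
  have e : (X 0 * X 0 * X 2 : MvPolynomial (Fin (2 * 3 + 2)) K) =
      propComb3 (0) (X 2) (-(X 1)) (0) (0) +
        (X 3 * (X 0 * X 1 - (X 1 * X 1) + X 1 * X 5 + X 2 * X 2) + X 4 * (X 0 * X 2 - (X 1 * X 2) + X 1 * X 4) + X 5 * (0) + X 6 * (0) + X 7 * (0)) := by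
    simp only [propComb3, plucker₁, plucker₂, plucker₃, plucker₄, plucker₅, map_one]; ring
  rw [e]
  exact Ideal.add_mem _ (propComb3_mem _ _ _ _ _) (propC3_killed _ _ _ _ _)

/-- `x_0 x_1 x_1 ∈ C`. [folklore] -/
private theorem propC3_c0_1_1 : (X 0 * X 1 * X 1 : MvPolynomial (Fin (2 * 3 + 2)) K) ∈ propC3 := by
  have e : (X 0 * X 1 * X 1 : MvPolynomial (Fin (2 * 3 + 2)) K) =
      propComb3 (-(X 0)) (-(X 0)) (-(X 0)) (X 1) (0) +
        (X 3 * (X 0 * X 0 - (2 * X 0 * X 1) - (X 0 * X 2) + X 0 * X 5 - (X 1 * X 1)) + X 4 * (-(X 0 * X 0) + 2 * X 0 * X 1 + X 0 * X 2 + X 0 * X 4 - (X 1 * X 2) - (X 1 * X 4)) + X 5 * (X 0 * X 1) + X 6 * (0) + X 7 * (0)) := by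
    simp only [propComb3, plucker₁, plucker₂, plucker₃, plucker₄, plucker₅, map_one]; ring
  rw [e]
  exact Ideal.add_mem _ (propComb3_mem _ _ _ _ _) (propC3_killed _ _ _ _ _)

/-- `x_0 x_1 x_2 ∈ C`. [folklore] -/
private theorem propC3_c0_1_2 : (X 0 * X 1 * X 2 : MvPolynomial (Fin (2 * 3 + 2)) K) ∈ propC3 := by
  have e : (X 0 * X 1 * X 2 : MvPolynomial (Fin (2 * 3 + 2)) K) =
      propComb3 (0) (0) (0) (-(X 1)) (0) +
        (X 3 * (X 0 * X 1 + X 1 * X 1) + X 4 * (-(X 0 * X 1) + X 1 * X 2 + X 1 * X 4) + X 5 * (0) + X 6 * (0) + X 7 * (0)) := by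
    simp only [propComb3, plucker₁, plucker₂, plucker₃, plucker₄, plucker₅, map_one]; ring
  rw [e]
  exact Ideal.add_mem _ (propComb3_mem _ _ _ _ _) (propC3_killed _ _ _ _ _)

/-- `x_0 x_2 x_2 ∈ C`. [folklore] -/
private theorem propC3_c0_2_2 : (X 0 * X 2 * X 2 : MvPolynomial (Fin (2 * 3 + 2)) K) ∈ propC3 := by
  have e : (X 0 * X 2 * X 2 : MvPolynomial (Fin (2 * 3 + 2)) K) =
      propComb3 (0) (0) (-(X 0)) (0) (0) +
        (X 3 * (X 0 * X 0 - (X 0 * X 1) + X 0 * X 5) + X 4 * (X 0 * X 4) + X 5 * (0) + X 6 * (0) + X 7 * (0)) := by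
    simp only [propComb3, plucker₁, plucker₂, plucker₃, plucker₄, plucker₅, map_one]; ring
  rw [e]
  exact Ideal.add_mem _ (propComb3_mem _ _ _ _ _) (propC3_killed _ _ _ _ _)

/-- `x_1 x_1 x_1 ∈ C`. [folklore] -/
private theorem propC3_c1_1_1 : (X 1 * X 1 * X 1 : MvPolynomial (Fin (2 * 3 + 2)) K) ∈ propC3 := by
  have e : (X 1 * X 1 * X 1 : MvPolynomial (Fin (2 * 3 + 2)) K) =
      propComb3 (-(X 1) + X 2) (-(X 1) + X 2) (-(2 * X 1) + X 2) (0) (0) +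
        (X 3 * (2 * X 0 * X 1 - (X 0 * X 2) - (2 * X 1 * X 1) + 2 * X 1 * X 5 + X 2 * X 2 - (X 2 * X 5)) + X 4 * (-(X 0 * X 1) + X 0 * X 2 + X 1 * X 1 + 2 * X 1 * X 4 - (X 2 * X 2) - (X 2 * X 4)) + X 5 * (X 1 * X 1 - (X 1 * X 2)) + X 6 * (0) + X 7 * (0)) := by
    simp only [propComb3, plucker₁, plucker₂, plucker₃, plucker₄, plucker₅, map_one]; ring
  rw [e]
  exact Ideal.add_mem _ (propComb3_mem _ _ _ _ _) (propC3_killed _ _ _ _ _)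

/-- `x_1 x_1 x_2 ∈ C`. [folklore] -/
private theorem propC3_c1_1_2 : (X 1 * X 1 * X 2 : MvPolynomial (Fin (2 * 3 + 2)) K) ∈ propC3 := by
  have e : (X 1 * X 1 * X 2 : MvPolynomial (Fin (2 * 3 + 2)) K) =
      propComb3 (-(X 2)) (-(X 2)) (X 1 - (X 2)) (0) (0) +
        (X 3 * (-(X 0 * X 1) + X 0 * X 2 + X 1 * X 1 - (X 1 * X 2) - (X 1 * X 5) - (X 2 * X 2) + X 2 * X 5) + X 4 * (-(X 0 * X 2) + X 1 * X 2 - (X 1 * X 4) + X 2 * X 2 + X 2 * X 4) + X 5 * (X 1 * X 2) + X 6 * (0) + X 7 * (0)) := by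
    simp only [propComb3, plucker₁, plucker₂, plucker₃, plucker₄, plucker₅, map_one]; ring
  rw [e]
  exact Ideal.add_mem _ (propComb3_mem _ _ _ _ _) (propC3_killed _ _ _ _ _)

/-- `x_1 x_2 x_2 ∈ C`. [folklore] -/
private theorem propC3_c1_2_2 : (X 1 * X 2 * X 2 : MvPolynomial (Fin (2 * 3 + 2)) K) ∈ propC3 := by
  have e : (X 1 * X 2 * X 2 : MvPolynomial (Fin (2 * 3 + 2)) K) =
      propComb3 (0) (0) (-(X 1)) (0) (0) +
        (X 3 * (X 0 * X 1 - (X 1 * X 1) + X 1 * X 5) + X 4 * (X 1 * X 4) + X 5 * (0) + X 6 * (0) + X 7 * (0)) := by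
    simp only [propComb3, plucker₁, plucker₂, plucker₃, plucker₄, plucker₅, map_one]; ring
  rw [e]
  exact Ideal.add_mem _ (propComb3_mem _ _ _ _ _) (propC3_killed _ _ _ _ _)

/-- `x_2 x_2 x_2 ∈ C`. [folklore] -/
private theorem propC3_c2_2_2 : (X 2 * X 2 * X 2 : MvPolynomial (Fin (2 * 3 + 2)) K) ∈ propC3 := by
  have e : (X 2 * X 2 * X 2 : MvPolynomial (Fin (2 * 3 + 2)) K) =
      propComb3 (0) (0) (-(X 2)) (0) (0) +
        (X 3 * (X 0 * X 2 - (X 1 * X 2) + X 2 * X 5) + X 4 * (X 2 * X 4) + X 5 * (0) + X 6 * (0) + X 7 * (0)) := by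
    simp only [propComb3, plucker₁, plucker₂, plucker₃, plucker₄, plucker₅, map_one]; ring
  rw [e]
  exact Ideal.add_mem _ (propComb3_mem _ _ _ _ _) (propC3_killed _ _ _ _ _)

/-- The killed variables lie in `C`. [folklore] -/
private theorem propC3_kill : ∀ v ∈ ({3, 4, 5, 6, 7} : Finset (Fin (2 * 3 + 2))), (X v : MvPolynomial (Fin (2 * 3 + 2)) K) ∈ propC3 := by
  intro v hv
  simp only [Finset.mem_insert, Finset.mem_singleton] at hv
  rcases hv with rfl | rfl | rfl | rfl | rfl
  exacts [propC3_X3, propC3_X4, propC3_X5, propC3_X6, propC3_X7]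

/-- All products of three variables lie in `C`. [folklore] -/
private theorem propC3_X_mul_X_mul_X (i j l : Fin (2 * 3 + 2)) :
    (X i * X j * X l : MvPolynomial (Fin (2 * 3 + 2)) K) ∈ propC3 :=
  forall_X_mul_X_mul_X_mem ({3, 4, 5, 6, 7} : Finset (Fin (2 * 3 + 2))) propC3_kill 0 1 2 (by decide)
    propC3_c0_0_0 propC3_c0_0_1 propC3_c0_0_2 propC3_c0_1_1 propC3_c0_1_2 propC3_c0_2_2 propC3_c1_1_1 propC3_c1_1_2 propC3_c1_2_2 propC3_c2_2_2 i j l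

/-- Every product of two variables is, modulo `μ₀`, in `C`. [folklore] -/
private theorem propC3_X_mul_X (i j : Fin (2 * 3 + 2)) :
    ∃ e : K, (X i * X j - C e * (X 0 * X 0) : MvPolynomial (Fin (2 * 3 + 2)) K) ∈ propC3 :=
  forall_X_mul_X_sub_mem (X 0 * X 0) ({3, 4, 5, 6, 7} : Finset (Fin (2 * 3 + 2))) propC3_kill 0 1 2 (by decide)
    ⟨_, propC3_q0_0⟩ ⟨_, propC3_q0_1⟩ ⟨_, propC3_q0_2⟩ ⟨_, propC3_q1_1⟩ ⟨_, propC3_q1_2⟩ ⟨_, propC3_q2_2⟩ i j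

/-- **(H), degree 1**: `H(S/C)(1) ≤ 3`. [folklore] -/
private theorem propC3_h₁ :
    finrank K (homogeneousSubmodule (Fin (2 * 3 + 2)) K 1) - finrank K (idealDegree (propC3 (K := K)) 1) ≤ 3 := by
  have h := hilbert_one_le_of_X_mem (J := propC3 (K := K)) (![3, 4, 5, 6, 7] : Fin 5 → Fin (2 * 3 + 2)) (by decide)
    (fun i => propC3_kill _ (by fin_cases i <;> simp))
  omega

/-- **(H), degree 2**: `H(S/C)(2) ≤ 1`. [folklore] -/
private theorem propC3_h₂ :
    finrank K (homogeneousSubmodule (Fin (2 * 3 + 2)) K 2) - finrank K (idealDegree (propC3 (K := K)) 2) ≤ 1 :=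
  hilbert_two_le_one_of_forall (X 0 * X 0) ((isHomogeneous_X K _).mul (isHomogeneous_X K _)) propC3_X_mul_X

/-- **(H), degree 3**: every cubic lies in `C`. [folklore] -/
private theorem propC3_h₃ (f : MvPolynomial (Fin (2 * 3 + 2)) K) (hf : f.IsHomogeneous 3) : f ∈ propC3 :=
  mem_of_forall_X_mul_X_mul_X_mem propC3_X_mul_X_mul_X f hf

open Literature.AlgebraicGeometry.Kloosterman2023 in
/-- **Proposition 6.4 for `k = 3` (cubic sixfolds with two 3-planes meeting in a point (census cell `(6,3,0)`)), an unconditional rational instance**: for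
`L₀₄ = -(X 0)`, `L₀₅ = X 0 - (X 4)`, `L₁₄ = -(X 1) + X 5`, `L₁₅ = -(X 2) + X 4`, `L₂₄ = X 2 + X 4`, `L₂₅ = -(X 3)`, `u = 1/t = 1` in `ℙ^7` (`3`
relations among the ten substituted forms modulo the tail), `I^{(t)} + (x_T)` has Hilbert function
`χ_4(m) + 3χ_4(m−1) + χ_4(m−2)` — Hilbert series `(1 + 3s + s²)/(1 − s)^4`, a `3`-dimensional linear section of the
cone over `G(2,5)`: the reduction hypothesis of `prop_6_4_hilbert_fibre_of_reduction` is checked with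
`y = (x_3, x_4, x_5, x_6)` by six quadratic identities modulo `X 0 * X 0` and ten cubic identities.
[cite: Kloosterman2025, Prop. 6.4 (proof)] -/
theorem prop_6_4_hilbert_fibre_instance_k3 (m : ℕ) :
    𝓗_3(pluckerIdeal (X ⟨0, by omega⟩) (X ⟨1, by omega⟩) (X ⟨2, by omega⟩) (X ⟨3, by omega⟩)
        (-(X 0)) (X 0 - (X 4)) (-(X 1) + X 5) (-(X 2) + X 4) (X 2 + X 4) (-(X 3)) (C (1 : K)) ⊔
        Ideal.span (X '' (tailVars 3 (3 + 4) : Set (Fin (2 * 3 + 2)))), m) =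
      chi 4 m + 3 * chi 4 ((m : ℤ) - 1) + chi 4 ((m : ℤ) - 2) := by
  have hL := plueckerSubst_isHomogeneous (n := 2 * 3 + 1) ⟨0, by omega⟩ ⟨1, by omega⟩ ⟨2, by omega⟩ ⟨3, by omega⟩
    (1 : K) (isHomogeneous_X K 0).neg ((isHomogeneous_X K 0).sub (isHomogeneous_X K 4)) ((isHomogeneous_X K 1).neg.add (isHomogeneous_X K 5)) ((isHomogeneous_X K 2).neg.add (isHomogeneous_X K 4)) ((isHomogeneous_X K 2).add (isHomogeneous_X K 4)) (isHomogeneous_X K 3).neg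
  have h1 := propC3_h₁ (K := K)
  have h2 := propC3_h₂ (K := K)
  have h3 := propC3_h₃ (K := K)
  have h := prop_6_4_hilbert_fibre_of_reduction (K := K) (k := 3) (by norm_num) (-(X 0)) (X 0 - (X 4)) (-(X 1) + X 5) (-(X 2) + X 4)
    (X 2 + X 4) (-(X 3)) 1 hL propY3 (fun _ => isHomogeneous_X K _) h1 h2 h3 m
  exact h


/-- **The Artinian reduction `(H)` holds at the `k = 3` instance of Prop. 6.4** (cubic sixfolds, cell `(6,3,0)`): for the instance forms
and `y = (x3, x4, x5, x6)`, the ideal `C = I^{(t)} + (x_T) + (y)` has `H(S/C)(1) ≤ 3`, `H(S/C)(2) ≤ 1` and contains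
every cubic — the three hypotheses `h₁, h₂, h₃` of `prop_6_4_hilbert_fibre_of_reduction`, exported for the general-fibre
theorem (`LinearSectionGeneralFibres`). [cite: Kloosterman2025, Prop. 6.4 (proof)] -/
theorem prop_6_4_reduction_instance_k3 :
    (finrank K (homogeneousSubmodule (Fin (2 * 3 + 2)) K 1) - finrank K (idealDegree
      (pluckerIdeal (X ⟨0, by omega⟩) (X ⟨1, by omega⟩) (X ⟨2, by omega⟩) (X ⟨3, by omega⟩)
          (-(X 0)) (X 0 - (X 4)) (-(X 1) + X 5) (-(X 2) + X 4) (X 2 + X 4) (-(X 3)) (C (1 : K)) ⊔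
        Ideal.span (X '' (tailVars 3 (3 + 4) : Set (Fin (2 * 3 + 2)))) ⊔
        Ideal.span (Set.range fun j : Fin (3 + 1) => (X (![3, 4, 5, 6] j) : MvPolynomial (Fin (2 * 3 + 2)) K))) 1) ≤ 3) ∧
    (finrank K (homogeneousSubmodule (Fin (2 * 3 + 2)) K 2) - finrank K (idealDegree
      (pluckerIdeal (X ⟨0, by omega⟩) (X ⟨1, by omega⟩) (X ⟨2, by omega⟩) (X ⟨3, by omega⟩)
          (-(X 0)) (X 0 - (X 4)) (-(X 1) + X 5) (-(X 2) + X 4) (X 2 + X 4) (-(X 3)) (C (1 : K)) ⊔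
        Ideal.span (X '' (tailVars 3 (3 + 4) : Set (Fin (2 * 3 + 2)))) ⊔
        Ideal.span (Set.range fun j : Fin (3 + 1) => (X (![3, 4, 5, 6] j) : MvPolynomial (Fin (2 * 3 + 2)) K))) 2) ≤ 1) ∧
    (∀ f : MvPolynomial (Fin (2 * 3 + 2)) K, f.IsHomogeneous 3 → f ∈
      pluckerIdeal (X ⟨0, by omega⟩) (X ⟨1, by omega⟩) (X ⟨2, by omega⟩) (X ⟨3, by omega⟩)
          (-(X 0)) (X 0 - (X 4)) (-(X 1) + X 5) (-(X 2) + X 4) (X 2 + X 4) (-(X 3)) (C (1 : K)) ⊔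
        Ideal.span (X '' (tailVars 3 (3 + 4) : Set (Fin (2 * 3 + 2)))) ⊔
        Ideal.span (Set.range fun j : Fin (3 + 1) => (X (![3, 4, 5, 6] j) : MvPolynomial (Fin (2 * 3 + 2)) K))) :=
  ⟨propC3_h₁, propC3_h₂, propC3_h₃⟩

end Prop64Instance3

/-! ## Proposition 6.4 for `k = 4` (cubic eightfolds with two 4-planes meeting in a line (census cell `(8,3,1)`)): a rational instance of the reduction hypothesis -/

section Prop64Instance4

local notation "𝓗_4(" I ", " m ")" =>
  (((finrank K (homogeneousSubmodule (Fin (2 * 4 + 2)) K m) - finrank K (idealDegree I m) : ℕ) : ℤ))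

/-- The reduction `y` = the coordinates `x_0, x_3, x_4, x_5, x_7`. [folklore] -/
private def propY4 : Fin (4 + 1) → MvPolynomial (Fin (2 * 4 + 2)) K := fun j => X (![0, 3, 4, 5, 7] j)

/-- The instance ideal `C = I^{(t)} + (x_T) + (y)` for `L₀₄ = -(X 1) + X 2`, `L₀₅ = X 1`, `L₁₄ = X 6`, `L₁₅ = X 2 + X 7`,
`L₂₄ = X 1 + X 7`, `L₂₅ = X 0 - (X 6)`, `u = 1`. [folklore] -/
private abbrev propC4 : Ideal (MvPolynomial (Fin (2 * 4 + 2)) K) :=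
  pluckerIdeal (X ⟨0, by omega⟩) (X ⟨1, by omega⟩) (X ⟨2, by omega⟩) (X ⟨3, by omega⟩)
      (-(X 1) + X 2) (X 1) (X 6) (X 2 + X 7) (X 1 + X 7) (X 0 - (X 6)) (C 1) ⊔
    Ideal.span (X '' (tailVars 4 (4 + 4) : Set (Fin (2 * 4 + 2)))) ⊔ Ideal.span (Set.range propY4)

/-- A combination of the five substituted Plücker quadrics of the instance. [folklore] -/
private def propComb4 (r₁ r₂ r₃ r₄ r₅ : MvPolynomial (Fin (2 * 4 + 2)) K) : MvPolynomial (Fin (2 * 4 + 2)) K :=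
  r₁ * plucker₁ (X 0) (X 1) (X 1 + X 7) (X 2) (-(X 6)) (-(X 1) + X 2) +
    r₂ * plucker₂ (X 0) (X 1) (X 0 - (X 6)) (X 2) (-(X 2 + X 7)) (X 1) +
    r₃ * plucker₃ (X 0) (X 1 + X 7) (X 0 - (X 6)) (-(X 6)) (-(X 2 + X 7)) (C 1 * X 3) +
    r₄ * plucker₄ (X 1) (X 1 + X 7) (X 0 - (X 6)) (-(X 1) + X 2) (X 1) (C 1 * X 3) +
    r₅ * plucker₅ (X 2) (-(X 6)) (-(X 2 + X 7)) (-(X 1) + X 2) (X 1) (C 1 * X 3)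

/-- Combinations of the generators lie in `C`. [folklore] -/
private theorem propComb4_mem (r₁ r₂ r₃ r₄ r₅ : MvPolynomial (Fin (2 * 4 + 2)) K) :
    propComb4 r₁ r₂ r₃ r₄ r₅ ∈ (propC4 : Ideal (MvPolynomial (Fin (2 * 4 + 2)) K)) := by
  have h : ∀ g ∈ ({plucker₁ (X 0) (X 1) (X 1 + X 7) (X 2) (-(X 6)) (-(X 1) + X 2),
      plucker₂ (X 0) (X 1) (X 0 - (X 6)) (X 2) (-(X 2 + X 7)) (X 1),
      plucker₃ (X 0) (X 1 + X 7) (X 0 - (X 6)) (-(X 6)) (-(X 2 + X 7)) (C 1 * X 3),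
      plucker₄ (X 1) (X 1 + X 7) (X 0 - (X 6)) (-(X 1) + X 2) (X 1) (C 1 * X 3),
      plucker₅ (X 2) (-(X 6)) (-(X 2 + X 7)) (-(X 1) + X 2) (X 1) (C 1 * X 3)} :
      Set (MvPolynomial (Fin (2 * 4 + 2)) K)), g ∈ (propC4 : Ideal (MvPolynomial (Fin (2 * 4 + 2)) K)) :=
    fun g hg => Ideal.mem_sup_left (Ideal.mem_sup_left (Ideal.subset_span hg))
  unfold propComb4
  refine Ideal.add_mem _ (Ideal.add_mem _ (Ideal.add_mem _ (Ideal.add_mem _ ?_ ?_) ?_) ?_) ?_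
  all_goals exact Ideal.mul_mem_left _ _ (h _ (by simp))

/-- Instance plumbing. [folklore] -/
private theorem propC4_X_mem (j : Fin (4 + 1)) : (X (![0, 3, 4, 5, 7] j) : MvPolynomial (Fin (2 * 4 + 2)) K) ∈ propC4 :=
  Ideal.mem_sup_right (Ideal.subset_span ⟨j, rfl⟩)

/-- Instance plumbing. [folklore] -/
private theorem propC4_X0 : (X 0 : MvPolynomial (Fin (2 * 4 + 2)) K) ∈ propC4 := propC4_X_mem 0
/-- Instance plumbing. [folklore] -/
private theorem propC4_X3 : (X 3 : MvPolynomial (Fin (2 * 4 + 2)) K) ∈ propC4 := propC4_X_mem 1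
/-- Instance plumbing. [folklore] -/
private theorem propC4_X4 : (X 4 : MvPolynomial (Fin (2 * 4 + 2)) K) ∈ propC4 := propC4_X_mem 2
/-- Instance plumbing. [folklore] -/
private theorem propC4_X5 : (X 5 : MvPolynomial (Fin (2 * 4 + 2)) K) ∈ propC4 := propC4_X_mem 3
/-- Instance plumbing. [folklore] -/
private theorem propC4_X7 : (X 7 : MvPolynomial (Fin (2 * 4 + 2)) K) ∈ propC4 := propC4_X_mem 4
/-- Instance plumbing. [folklore] -/
private theorem propC4_X8 : (X 8 : MvPolynomial (Fin (2 * 4 + 2)) K) ∈ propC4 :=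
  Ideal.mem_sup_left (Ideal.mem_sup_right (Ideal.subset_span ⟨8, by simp [tailVars], rfl⟩))
/-- Instance plumbing. [folklore] -/
private theorem propC4_X9 : (X 9 : MvPolynomial (Fin (2 * 4 + 2)) K) ∈ propC4 :=
  Ideal.mem_sup_left (Ideal.mem_sup_right (Ideal.subset_span ⟨9, by simp [tailVars], rfl⟩))

/-- Multiples of the killed variables lie in `C`. [folklore] -/
private theorem propC4_killed (b0 b3 b4 b5 b7 b8 b9 : MvPolynomial (Fin (2 * 4 + 2)) K) :
    X 0 * b0 + X 3 * b3 + X 4 * b4 + X 5 * b5 + X 7 * b7 + X 8 * b8 + X 9 * b9 ∈ (propC4 : Ideal (MvPolynomial (Fin (2 * 4 + 2)) K)) :=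
  Ideal.add_mem _ (Ideal.add_mem _ (Ideal.add_mem _ (Ideal.add_mem _ (Ideal.add_mem _ (Ideal.add_mem _ (Ideal.mul_mem_right _ _ propC4_X0) (Ideal.mul_mem_right _ _ propC4_X3)) (Ideal.mul_mem_right _ _ propC4_X4)) (Ideal.mul_mem_right _ _ propC4_X5)) (Ideal.mul_mem_right _ _ propC4_X7)) (Ideal.mul_mem_right _ _ propC4_X8)) (Ideal.mul_mem_right _ _ propC4_X9)

/-- `x_1 x_1 − (-2)·μ₀ ∈ C`, `μ₀ = X 1 * X 2`. [folklore] -/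
private theorem propC4_q1_1 : (X 1 * X 1 - C (-2 : K) * (X 1 * X 2) : MvPolynomial (Fin (2 * 4 + 2)) K) ∈ propC4 := by
  have e : (X 1 * X 1 - C (-2 : K) * (X 1 * X 2) : MvPolynomial (Fin (2 * 4 + 2)) K) =
      propComb4 (1) (1) (0) (-1) (0) +
        (X 0 * (-(X 1) - (X 2)) + X 3 * (X 1) + X 4 * (0) + X 5 * (0) + X 7 * (-(2 * X 1) - (X 2)) + X 8 * (0) + X 9 * (0)) := by
    simp only [propComb4, plucker₁, plucker₂, plucker₃, plucker₄, plucker₅, map_one, map_neg, map_ofNat]; ring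
  rw [e]
  exact Ideal.add_mem _ (propComb4_mem _ _ _ _ _) (propC4_killed _ _ _ _ _ _ _)

/-- `x_1 x_2 − (1)·μ₀ ∈ C`, `μ₀ = X 1 * X 2`. [folklore] -/
private theorem propC4_q1_2 : (X 1 * X 2 - C (1 : K) * (X 1 * X 2) : MvPolynomial (Fin (2 * 4 + 2)) K) ∈ propC4 := by
  have e : (X 1 * X 2 - C (1 : K) * (X 1 * X 2) : MvPolynomial (Fin (2 * 4 + 2)) K) =
      propComb4 (0) (0) (0) (0) (0) +
        (X 0 * (0) + X 3 * (0) + X 4 * (0) + X 5 * (0) + X 7 * (0) + X 8 * (0) + X 9 * (0)) := by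
    simp only [propComb4, plucker₁, plucker₂, plucker₃, plucker₄, plucker₅, map_one]; ring
  rw [e]
  exact Ideal.add_mem _ (propComb4_mem _ _ _ _ _) (propC4_killed _ _ _ _ _ _ _)

/-- `x_1 x_6 − (-1)·μ₀ ∈ C`, `μ₀ = X 1 * X 2`. [folklore] -/
private theorem propC4_q1_6 : (X 1 * X 6 - C (-1 : K) * (X 1 * X 2) : MvPolynomial (Fin (2 * 4 + 2)) K) ∈ propC4 := by
  have e : (X 1 * X 6 - C (-1 : K) * (X 1 * X 2) : MvPolynomial (Fin (2 * 4 + 2)) K) =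
      propComb4 (1) (0) (0) (0) (0) +
        (X 0 * (X 1 - (X 2)) + X 3 * (0) + X 4 * (0) + X 5 * (0) + X 7 * (-(X 2)) + X 8 * (0) + X 9 * (0)) := by
    simp only [propComb4, plucker₁, plucker₂, plucker₃, plucker₄, plucker₅, map_one, map_neg]; ring
  rw [e]
  exact Ideal.add_mem _ (propComb4_mem _ _ _ _ _) (propC4_killed _ _ _ _ _ _ _)

/-- `x_2 x_2 − (0)·μ₀ ∈ C`, `μ₀ = X 1 * X 2`. [folklore] -/
private theorem propC4_q2_2 : (X 2 * X 2 - C (0 : K) * (X 1 * X 2) : MvPolynomial (Fin (2 * 4 + 2)) K) ∈ propC4 := by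
  have e : (X 2 * X 2 - C (0 : K) * (X 1 * X 2) : MvPolynomial (Fin (2 * 4 + 2)) K) =
      propComb4 (1) (0) (0) (0) (-1) +
        (X 0 * (X 1 - (X 2)) + X 3 * (X 2) + X 4 * (0) + X 5 * (0) + X 7 * (X 1 - (2 * X 2)) + X 8 * (0) + X 9 * (0)) := by
    simp only [propComb4, plucker₁, plucker₂, plucker₃, plucker₄, plucker₅, map_one, map_zero]; ring
  rw [e]
  exact Ideal.add_mem _ (propComb4_mem _ _ _ _ _) (propC4_killed _ _ _ _ _ _ _)

/-- `x_2 x_6 − (1)·μ₀ ∈ C`, `μ₀ = X 1 * X 2`. [folklore] -/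
private theorem propC4_q2_6 : (X 2 * X 6 - C (1 : K) * (X 1 * X 2) : MvPolynomial (Fin (2 * 4 + 2)) K) ∈ propC4 := by
  have e : (X 2 * X 6 - C (1 : K) * (X 1 * X 2) : MvPolynomial (Fin (2 * 4 + 2)) K) =
      propComb4 (0) (-1) (0) (0) (0) +
        (X 0 * (X 1 + X 2) + X 3 * (0) + X 4 * (0) + X 5 * (0) + X 7 * (X 1) + X 8 * (0) + X 9 * (0)) := by
    simp only [propComb4, plucker₁, plucker₂, plucker₃, plucker₄, plucker₅, map_one]; ring
  rw [e]
  exact Ideal.add_mem _ (propComb4_mem _ _ _ _ _) (propC4_killed _ _ _ _ _ _ _)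

/-- `x_6 x_6 − (-1)·μ₀ ∈ C`, `μ₀ = X 1 * X 2`. [folklore] -/
private theorem propC4_q6_6 : (X 6 * X 6 - C (-1 : K) * (X 1 * X 2) : MvPolynomial (Fin (2 * 4 + 2)) K) ∈ propC4 := by
  have e : (X 6 * X 6 - C (-1 : K) * (X 1 * X 2) : MvPolynomial (Fin (2 * 4 + 2)) K) =
      propComb4 (0) (0) (1) (0) (0) +
        (X 0 * (-(X 3) + X 6) + X 3 * (0) + X 4 * (0) + X 5 * (0) + X 7 * (-(X 1) - (X 2) - (X 7)) + X 8 * (0) + X 9 * (0)) := by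
    simp only [propComb4, plucker₁, plucker₂, plucker₃, plucker₄, plucker₅, map_one, map_neg]; ring
  rw [e]
  exact Ideal.add_mem _ (propComb4_mem _ _ _ _ _) (propC4_killed _ _ _ _ _ _ _)

/-- `x_1 x_1 x_1 ∈ C`. [folklore] -/
private theorem propC4_c1_1_1 : (X 1 * X 1 * X 1 : MvPolynomial (Fin (2 * 4 + 2)) K) ∈ propC4 := by
  have e : (X 1 * X 1 * X 1 : MvPolynomial (Fin (2 * 4 + 2)) K) =
      propComb4 (X 1 - (2 * X 2)) (-(3 * X 1) + 2 * X 2) (0) (-(X 1) - (2 * X 2)) (0) +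
        (X 0 * (3 * X 1 * X 1 - (3 * X 1 * X 2) + 2 * X 2 * X 2) + X 3 * (X 1 * X 1 + 2 * X 1 * X 2) + X 4 * (0) + X 5 * (0) + X 7 * (2 * X 1 * X 1 - (5 * X 1 * X 2) + 2 * X 2 * X 2) + X 8 * (0) + X 9 * (0)) := by
    simp only [propComb4, plucker₁, plucker₂, plucker₃, plucker₄, plucker₅, map_one]; ring
  rw [e]
  exact Ideal.add_mem _ (propComb4_mem _ _ _ _ _) (propC4_killed _ _ _ _ _ _ _)

/-- `x_1 x_1 x_2 ∈ C`. [folklore] -/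
private theorem propC4_c1_1_2 : (X 1 * X 1 * X 2 : MvPolynomial (Fin (2 * 4 + 2)) K) ∈ propC4 := by
  have e : (X 1 * X 1 * X 2 : MvPolynomial (Fin (2 * 4 + 2)) K) =
      propComb4 (X 2) (2 * X 1 - (X 2)) (0) (X 2) (0) +
        (X 0 * (-(2 * X 1 * X 1) + X 1 * X 2 - (X 2 * X 2)) + X 3 * (-(X 1 * X 2)) + X 4 * (0) + X 5 * (0) + X 7 * (-(2 * X 1 * X 1) + 2 * X 1 * X 2 - (X 2 * X 2)) + X 8 * (0) + X 9 * (0)) := by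
    simp only [propComb4, plucker₁, plucker₂, plucker₃, plucker₄, plucker₅, map_one]; ring
  rw [e]
  exact Ideal.add_mem _ (propComb4_mem _ _ _ _ _) (propC4_killed _ _ _ _ _ _ _)

/-- `x_1 x_1 x_6 ∈ C`. [folklore] -/
private theorem propC4_c1_1_6 : (X 1 * X 1 * X 6 : MvPolynomial (Fin (2 * 4 + 2)) K) ∈ propC4 := by
  have e : (X 1 * X 1 * X 6 : MvPolynomial (Fin (2 * 4 + 2)) K) =
      propComb4 (X 1 - (X 2)) (-(2 * X 1) + X 2) (0) (-(X 2)) (0) +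
        (X 0 * (3 * X 1 * X 1 - (2 * X 1 * X 2) + X 2 * X 2) + X 3 * (X 1 * X 2) + X 4 * (0) + X 5 * (0) + X 7 * (2 * X 1 * X 1 - (3 * X 1 * X 2) + X 2 * X 2) + X 8 * (0) + X 9 * (0)) := by
    simp only [propComb4, plucker₁, plucker₂, plucker₃, plucker₄, plucker₅, map_one]; ring
  rw [e]
  exact Ideal.add_mem _ (propComb4_mem _ _ _ _ _) (propC4_killed _ _ _ _ _ _ _)

/-- `x_1 x_2 x_2 ∈ C`. [folklore] -/
private theorem propC4_c1_2_2 : (X 1 * X 2 * X 2 : MvPolynomial (Fin (2 * 4 + 2)) K) ∈ propC4 := by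
  have e : (X 1 * X 2 * X 2 : MvPolynomial (Fin (2 * 4 + 2)) K) =
      propComb4 (0) (-(X 1) + X 2) (0) (-(X 2)) (0) +
        (X 0 * (X 1 * X 1 - (X 1 * X 2)) + X 3 * (X 1 * X 2) + X 4 * (0) + X 5 * (0) + X 7 * (X 1 * X 1 - (2 * X 1 * X 2)) + X 8 * (0) + X 9 * (0)) := by
    simp only [propComb4, plucker₁, plucker₂, plucker₃, plucker₄, plucker₅, map_one]; ring
  rw [e]
  exact Ideal.add_mem _ (propComb4_mem _ _ _ _ _) (propC4_killed _ _ _ _ _ _ _)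

/-- `x_1 x_2 x_6 ∈ C`. [folklore] -/
private theorem propC4_c1_2_6 : (X 1 * X 2 * X 6 : MvPolynomial (Fin (2 * 4 + 2)) K) ∈ propC4 := by
  have e : (X 1 * X 2 * X 6 : MvPolynomial (Fin (2 * 4 + 2)) K) =
      propComb4 (X 2) (X 1 - (X 2)) (0) (X 2) (0) +
        (X 0 * (-(X 1 * X 1) + 2 * X 1 * X 2 - (X 2 * X 2)) + X 3 * (-(X 1 * X 2)) + X 4 * (0) + X 5 * (0) + X 7 * (-(X 1 * X 1) + 2 * X 1 * X 2 - (X 2 * X 2)) + X 8 * (0) + X 9 * (0)) := by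
    simp only [propComb4, plucker₁, plucker₂, plucker₃, plucker₄, plucker₅, map_one]; ring
  rw [e]
  exact Ideal.add_mem _ (propComb4_mem _ _ _ _ _) (propC4_killed _ _ _ _ _ _ _)

/-- `x_1 x_6 x_6 ∈ C`. [folklore] -/
private theorem propC4_c1_6_6 : (X 1 * X 6 * X 6 : MvPolynomial (Fin (2 * 4 + 2)) K) ∈ propC4 := by
  have e : (X 1 * X 6 * X 6 : MvPolynomial (Fin (2 * 4 + 2)) K) =
      propComb4 (-(X 2) + X 6) (-(X 1) + X 2) (0) (-(X 2)) (0) +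
        (X 0 * (X 1 * X 1 - (2 * X 1 * X 2) + X 1 * X 6 + X 2 * X 2 - (X 2 * X 6)) + X 3 * (X 1 * X 2) + X 4 * (0) + X 5 * (0) + X 7 * (X 1 * X 1 - (2 * X 1 * X 2) + X 2 * X 2 - (X 2 * X 6)) + X 8 * (0) + X 9 * (0)) := by
    simp only [propComb4, plucker₁, plucker₂, plucker₃, plucker₄, plucker₅, map_one]; ring
  rw [e]
  exact Ideal.add_mem _ (propComb4_mem _ _ _ _ _) (propC4_killed _ _ _ _ _ _ _)

/-- `x_2 x_2 x_2 ∈ C`. [folklore] -/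
private theorem propC4_c2_2_2 : (X 2 * X 2 * X 2 : MvPolynomial (Fin (2 * 4 + 2)) K) ∈ propC4 := by
  have e : (X 2 * X 2 * X 2 : MvPolynomial (Fin (2 * 4 + 2)) K) =
      propComb4 (X 2) (0) (0) (0) (-(X 2)) +
        (X 0 * (X 1 * X 2 - (X 2 * X 2)) + X 3 * (X 2 * X 2) + X 4 * (0) + X 5 * (0) + X 7 * (X 1 * X 2 - (2 * X 2 * X 2)) + X 8 * (0) + X 9 * (0)) := by
    simp only [propComb4, plucker₁, plucker₂, plucker₃, plucker₄, plucker₅, map_one]; ring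
  rw [e]
  exact Ideal.add_mem _ (propComb4_mem _ _ _ _ _) (propC4_killed _ _ _ _ _ _ _)

/-- `x_2 x_2 x_6 ∈ C`. [folklore] -/
private theorem propC4_c2_2_6 : (X 2 * X 2 * X 6 : MvPolynomial (Fin (2 * 4 + 2)) K) ∈ propC4 := by
  have e : (X 2 * X 2 * X 6 : MvPolynomial (Fin (2 * 4 + 2)) K) =
      propComb4 (0) (-(X 1)) (0) (-(X 2)) (0) +
        (X 0 * (X 1 * X 1 + X 2 * X 2) + X 3 * (X 1 * X 2) + X 4 * (0) + X 5 * (0) + X 7 * (X 1 * X 1 - (X 1 * X 2)) + X 8 * (0) + X 9 * (0)) := by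
    simp only [propComb4, plucker₁, plucker₂, plucker₃, plucker₄, plucker₅, map_one]; ring
  rw [e]
  exact Ideal.add_mem _ (propComb4_mem _ _ _ _ _) (propC4_killed _ _ _ _ _ _ _)

/-- `x_2 x_6 x_6 ∈ C`. [folklore] -/
private theorem propC4_c2_6_6 : (X 2 * X 6 * X 6 : MvPolynomial (Fin (2 * 4 + 2)) K) ∈ propC4 := by
  have e : (X 2 * X 6 * X 6 : MvPolynomial (Fin (2 * 4 + 2)) K) =
      propComb4 (X 2) (X 1 - (X 2) - (X 6)) (0) (X 2) (0) +
        (X 0 * (-(X 1 * X 1) + 2 * X 1 * X 2 + X 1 * X 6 - (X 2 * X 2) + X 2 * X 6) + X 3 * (-(X 1 * X 2)) + X 4 * (0) + X 5 * (0) + X 7 * (-(X 1 * X 1) + 2 * X 1 * X 2 + X 1 * X 6 - (X 2 * X 2)) + X 8 * (0) + X 9 * (0)) := by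
    simp only [propComb4, plucker₁, plucker₂, plucker₃, plucker₄, plucker₅, map_one]; ring
  rw [e]
  exact Ideal.add_mem _ (propComb4_mem _ _ _ _ _) (propC4_killed _ _ _ _ _ _ _)

/-- `x_6 x_6 x_6 ∈ C`. [folklore] -/
private theorem propC4_c6_6_6 : (X 6 * X 6 * X 6 : MvPolynomial (Fin (2 * 4 + 2)) K) ∈ propC4 := by
  have e : (X 6 * X 6 * X 6 : MvPolynomial (Fin (2 * 4 + 2)) K) =
      propComb4 (-(X 2)) (-(X 1) + X 2) (X 6) (-(X 2)) (0) +
        (X 0 * (X 1 * X 1 - (2 * X 1 * X 2) + X 2 * X 2 - (X 3 * X 6) + X 6 * X 6) + X 3 * (X 1 * X 2) + X 4 * (0) + X 5 * (0) + X 7 * (X 1 * X 1 - (2 * X 1 * X 2) - (X 1 * X 6) + X 2 * X 2 - (X 2 * X 6) - (X 6 * X 7)) + X 8 * (0) + X 9 * (0)) := by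
    simp only [propComb4, plucker₁, plucker₂, plucker₃, plucker₄, plucker₅, map_one]; ring
  rw [e]
  exact Ideal.add_mem _ (propComb4_mem _ _ _ _ _) (propC4_killed _ _ _ _ _ _ _)

/-- The killed variables lie in `C`. [folklore] -/
private theorem propC4_kill : ∀ v ∈ ({0, 3, 4, 5, 7, 8, 9} : Finset (Fin (2 * 4 + 2))), (X v : MvPolynomial (Fin (2 * 4 + 2)) K) ∈ propC4 := by
  intro v hv
  simp only [Finset.mem_insert, Finset.mem_singleton] at hv
  rcases hv with rfl | rfl | rfl | rfl | rfl | rfl | rfl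
  exacts [propC4_X0, propC4_X3, propC4_X4, propC4_X5, propC4_X7, propC4_X8, propC4_X9]

/-- All products of three variables lie in `C`. [folklore] -/
private theorem propC4_X_mul_X_mul_X (i j l : Fin (2 * 4 + 2)) :
    (X i * X j * X l : MvPolynomial (Fin (2 * 4 + 2)) K) ∈ propC4 :=
  forall_X_mul_X_mul_X_mem ({0, 3, 4, 5, 7, 8, 9} : Finset (Fin (2 * 4 + 2))) propC4_kill 1 2 6 (by decide)
    propC4_c1_1_1 propC4_c1_1_2 propC4_c1_1_6 propC4_c1_2_2 propC4_c1_2_6 propC4_c1_6_6 propC4_c2_2_2 propC4_c2_2_6 propC4_c2_6_6 propC4_c6_6_6 i j l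

/-- Every product of two variables is, modulo `μ₀`, in `C`. [folklore] -/
private theorem propC4_X_mul_X (i j : Fin (2 * 4 + 2)) :
    ∃ e : K, (X i * X j - C e * (X 1 * X 2) : MvPolynomial (Fin (2 * 4 + 2)) K) ∈ propC4 :=
  forall_X_mul_X_sub_mem (X 1 * X 2) ({0, 3, 4, 5, 7, 8, 9} : Finset (Fin (2 * 4 + 2))) propC4_kill 1 2 6 (by decide)
    ⟨_, propC4_q1_1⟩ ⟨_, propC4_q1_2⟩ ⟨_, propC4_q1_6⟩ ⟨_, propC4_q2_2⟩ ⟨_, propC4_q2_6⟩ ⟨_, propC4_q6_6⟩ i j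

/-- **(H), degree 1**: `H(S/C)(1) ≤ 3`. [folklore] -/
private theorem propC4_h₁ :
    finrank K (homogeneousSubmodule (Fin (2 * 4 + 2)) K 1) - finrank K (idealDegree (propC4 (K := K)) 1) ≤ 3 := by
  have h := hilbert_one_le_of_X_mem (J := propC4 (K := K)) (![0, 3, 4, 5, 7, 8, 9] : Fin 7 → Fin (2 * 4 + 2)) (by decide)
    (fun i => propC4_kill _ (by fin_cases i <;> simp))
  omega

/-- **(H), degree 2**: `H(S/C)(2) ≤ 1`. [folklore] -/
private theorem propC4_h₂ :
    finrank K (homogeneousSubmodule (Fin (2 * 4 + 2)) K 2) - finrank K (idealDegree (propC4 (K := K)) 2) ≤ 1 :=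
  hilbert_two_le_one_of_forall (X 1 * X 2) ((isHomogeneous_X K _).mul (isHomogeneous_X K _)) propC4_X_mul_X

/-- **(H), degree 3**: every cubic lies in `C`. [folklore] -/
private theorem propC4_h₃ (f : MvPolynomial (Fin (2 * 4 + 2)) K) (hf : f.IsHomogeneous 3) : f ∈ propC4 :=
  mem_of_forall_X_mul_X_mul_X_mem propC4_X_mul_X_mul_X f hf

open Literature.AlgebraicGeometry.Kloosterman2023 in
/-- **Proposition 6.4 for `k = 4` (cubic eightfolds with two 4-planes meeting in a line (census cell `(8,3,1)`)), an unconditional rational instance**: for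
`L₀₄ = -(X 1) + X 2`, `L₀₅ = X 1`, `L₁₄ = X 6`, `L₁₅ = X 2 + X 7`, `L₂₄ = X 1 + X 7`, `L₂₅ = X 0 - (X 6)`, `u = 1/t = 1` in `ℙ^9` (`2`
relations among the ten substituted forms modulo the tail), `I^{(t)} + (x_T)` has Hilbert function
`χ_5(m) + 3χ_5(m−1) + χ_5(m−2)` — Hilbert series `(1 + 3s + s²)/(1 − s)^5`, a `4`-dimensional linear section of the
cone over `G(2,5)`: the reduction hypothesis of `prop_6_4_hilbert_fibre_of_reduction` is checked with
`y = (x_0, x_3, x_4, x_5, x_7)` by six quadratic identities modulo `X 1 * X 2` and ten cubic identities.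
[cite: Kloosterman2025, Prop. 6.4 (proof)] -/
theorem prop_6_4_hilbert_fibre_instance_k4 (m : ℕ) :
    𝓗_4(pluckerIdeal (X ⟨0, by omega⟩) (X ⟨1, by omega⟩) (X ⟨2, by omega⟩) (X ⟨3, by omega⟩)
        (-(X 1) + X 2) (X 1) (X 6) (X 2 + X 7) (X 1 + X 7) (X 0 - (X 6)) (C (1 : K)) ⊔
        Ideal.span (X '' (tailVars 4 (4 + 4) : Set (Fin (2 * 4 + 2)))), m) =
      chi 5 m + 3 * chi 5 ((m : ℤ) - 1) + chi 5 ((m : ℤ) - 2) := by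
  have hL := plueckerSubst_isHomogeneous (n := 2 * 4 + 1) ⟨0, by omega⟩ ⟨1, by omega⟩ ⟨2, by omega⟩ ⟨3, by omega⟩
    (1 : K) ((isHomogeneous_X K 1).neg.add (isHomogeneous_X K 2)) (isHomogeneous_X K 1) (isHomogeneous_X K 6) ((isHomogeneous_X K 2).add (isHomogeneous_X K 7)) ((isHomogeneous_X K 1).add (isHomogeneous_X K 7)) ((isHomogeneous_X K 0).sub (isHomogeneous_X K 6))
  have h1 := propC4_h₁ (K := K)
  have h2 := propC4_h₂ (K := K)
  have h3 := propC4_h₃ (K := K)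
  have h := prop_6_4_hilbert_fibre_of_reduction (K := K) (k := 4) (by norm_num) (-(X 1) + X 2) (X 1) (X 6) (X 2 + X 7)
    (X 1 + X 7) (X 0 - (X 6)) 1 hL propY4 (fun _ => isHomogeneous_X K _) h1 h2 h3 m
  exact h


/-- **The Artinian reduction `(H)` holds at the `k = 4` instance of Prop. 6.4** (cubic eightfolds, cell `(8,3,1)`): for the instance forms
and `y = (x0, x3, x4, x5, x7)`, the ideal `C = I^{(t)} + (x_T) + (y)` has `H(S/C)(1) ≤ 3`, `H(S/C)(2) ≤ 1` and contains
every cubic — the three hypotheses `h₁, h₂, h₃` of `prop_6_4_hilbert_fibre_of_reduction`, exported for the general-fibre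
theorem (`LinearSectionGeneralFibres`). [cite: Kloosterman2025, Prop. 6.4 (proof)] -/
theorem prop_6_4_reduction_instance_k4 :
    (finrank K (homogeneousSubmodule (Fin (2 * 4 + 2)) K 1) - finrank K (idealDegree
      (pluckerIdeal (X ⟨0, by omega⟩) (X ⟨1, by omega⟩) (X ⟨2, by omega⟩) (X ⟨3, by omega⟩)
          (-(X 1) + X 2) (X 1) (X 6) (X 2 + X 7) (X 1 + X 7) (X 0 - (X 6)) (C (1 : K)) ⊔
        Ideal.span (X '' (tailVars 4 (4 + 4) : Set (Fin (2 * 4 + 2)))) ⊔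
        Ideal.span (Set.range fun j : Fin (4 + 1) => (X (![0, 3, 4, 5, 7] j) : MvPolynomial (Fin (2 * 4 + 2)) K))) 1) ≤ 3) ∧
    (finrank K (homogeneousSubmodule (Fin (2 * 4 + 2)) K 2) - finrank K (idealDegree
      (pluckerIdeal (X ⟨0, by omega⟩) (X ⟨1, by omega⟩) (X ⟨2, by omega⟩) (X ⟨3, by omega⟩)
          (-(X 1) + X 2) (X 1) (X 6) (X 2 + X 7) (X 1 + X 7) (X 0 - (X 6)) (C (1 : K)) ⊔
        Ideal.span (X '' (tailVars 4 (4 + 4) : Set (Fin (2 * 4 + 2)))) ⊔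
        Ideal.span (Set.range fun j : Fin (4 + 1) => (X (![0, 3, 4, 5, 7] j) : MvPolynomial (Fin (2 * 4 + 2)) K))) 2) ≤ 1) ∧
    (∀ f : MvPolynomial (Fin (2 * 4 + 2)) K, f.IsHomogeneous 3 → f ∈
      pluckerIdeal (X ⟨0, by omega⟩) (X ⟨1, by omega⟩) (X ⟨2, by omega⟩) (X ⟨3, by omega⟩)
          (-(X 1) + X 2) (X 1) (X 6) (X 2 + X 7) (X 1 + X 7) (X 0 - (X 6)) (C (1 : K)) ⊔
        Ideal.span (X '' (tailVars 4 (4 + 4) : Set (Fin (2 * 4 + 2)))) ⊔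
        Ideal.span (Set.range fun j : Fin (4 + 1) => (X (![0, 3, 4, 5, 7] j) : MvPolynomial (Fin (2 * 4 + 2)) K))) :=
  ⟨propC4_h₁, propC4_h₂, propC4_h₃⟩

end Prop64Instance4

/-! ## Remark 6.7 for `k = 3`: a rational instance of the reduction hypothesis -/

section Rem67Instance3

local notation "𝓗r_3(" I ", " m ")" =>
  (((finrank K (homogeneousSubmodule (Fin (2 * 3 + 2)) K m) - finrank K (idealDegree I m) : ℕ) : ℤ))

/-- The reduction `y` = the coordinates `x_2, x_3, x_5, x_6`. [folklore] -/
private def remY3 : Fin (3 + 1) → MvPolynomial (Fin (2 * 3 + 2)) K := fun j => X (![2, 3, 5, 6] j)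

/-- The instance ideal `C = I_t + (x_T) + (y)` for `L₀₅ = X 0 + X 3`, `L₁₅ = X 1 + X 3`, `L₂₃ = X 6`, `L₂₄ = X 0 - (X 4)`, `t = 1`. [folklore] -/
private abbrev remC3 : Ideal (MvPolynomial (Fin (2 * 3 + 2)) K) :=
  scrollFibreIdeal (tailVars 3 (3 + 4)) ⟨0, by omega⟩ ⟨1, by omega⟩ ⟨3, by omega⟩ ⟨4, by omega⟩
      (X 0 + X 3) (X 1 + X 3) (X 6) (X 0 - (X 4)) 1 ⊔ Ideal.span (Set.range remY3)

/-- A combination of the six printed generators of `I_t` for the instance. [folklore] -/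
private def remComb3 (r₁ r₂ r₃ r₄ r₅ r₆ : MvPolynomial (Fin (2 * 3 + 2)) K) : MvPolynomial (Fin (2 * 3 + 2)) K :=
  r₁ * (X 0 * X 3 - C 1 * (X 0 - (X 4)) * (X 1 + X 3)) + r₂ * (X 0 * X 4 + C 1 * (X 1 + X 3) * (X 6)) + r₃ * (X 1 * X 3 + C 1 * (X 0 - (X 4)) * (X 0 + X 3)) + r₄ * (X 1 * X 4 - C 1 * (X 0 + X 3) * (X 6)) +
    r₅ * (X 0 * (X 0 + X 3) + X 1 * (X 1 + X 3)) + r₆ * (C 1 * (X 3 * (X 6) + X 4 * (X 0 - (X 4))))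

/-- Combinations of the generators lie in `C`. [folklore] -/
private theorem remComb3_mem (r₁ r₂ r₃ r₄ r₅ r₆ : MvPolynomial (Fin (2 * 3 + 2)) K) :
    remComb3 r₁ r₂ r₃ r₄ r₅ r₆ ∈ (remC3 : Ideal (MvPolynomial (Fin (2 * 3 + 2)) K)) := by
  have h : ∀ g ∈ ({X ⟨0, by omega⟩ * X ⟨3, by omega⟩ - C 1 * (X 0 - (X 4)) * (X 1 + X 3), X ⟨0, by omega⟩ * X ⟨4, by omega⟩ + C 1 * (X 1 + X 3) * (X 6), X ⟨1, by omega⟩ * X ⟨3, by omega⟩ + C 1 * (X 0 - (X 4)) * (X 0 + X 3), X ⟨1, by omega⟩ * X ⟨4, by omega⟩ - C 1 * (X 0 + X 3) * (X 6), X ⟨0, by omega⟩ * (X 0 + X 3) + X ⟨1, by omega⟩ * (X 1 + X 3), C 1 * (X ⟨3, by omega⟩ * (X 6) + X ⟨4, by omega⟩ * (X 0 - (X 4)))} : Set (MvPolynomial (Fin (2 * 3 + 2)) K)),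
      g ∈ (remC3 : Ideal (MvPolynomial (Fin (2 * 3 + 2)) K)) := by
    intro g hg
    refine Ideal.mem_sup_left ?_
    rw [scrollFibreIdeal_eq_span]
    exact Ideal.mem_sup_left (Ideal.subset_span hg)
  unfold remComb3
  refine Ideal.add_mem _ (Ideal.add_mem _ (Ideal.add_mem _ (Ideal.add_mem _ (Ideal.add_mem _ ?_ ?_) ?_) ?_) ?_) ?_
  all_goals exact Ideal.mul_mem_left _ _ (h _ (by simp))

/-- Instance plumbing. [folklore] -/
private theorem remC3_X_mem (j : Fin (3 + 1)) : (X (![2, 3, 5, 6] j) : MvPolynomial (Fin (2 * 3 + 2)) K) ∈ remC3 :=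
  Ideal.mem_sup_right (Ideal.subset_span ⟨j, rfl⟩)

/-- Instance plumbing. [folklore] -/
private theorem remC3_X2 : (X 2 : MvPolynomial (Fin (2 * 3 + 2)) K) ∈ remC3 := remC3_X_mem 0
/-- Instance plumbing. [folklore] -/
private theorem remC3_X3 : (X 3 : MvPolynomial (Fin (2 * 3 + 2)) K) ∈ remC3 := remC3_X_mem 1
/-- Instance plumbing. [folklore] -/
private theorem remC3_X5 : (X 5 : MvPolynomial (Fin (2 * 3 + 2)) K) ∈ remC3 := remC3_X_mem 2
/-- Instance plumbing. [folklore] -/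
private theorem remC3_X6 : (X 6 : MvPolynomial (Fin (2 * 3 + 2)) K) ∈ remC3 := remC3_X_mem 3
/-- Instance plumbing. [folklore] -/
private theorem remC3_X7 : (X 7 : MvPolynomial (Fin (2 * 3 + 2)) K) ∈ remC3 := by
  refine Ideal.mem_sup_left ?_
  rw [scrollFibreIdeal_eq_span]
  exact Ideal.mem_sup_right (Ideal.subset_span ⟨7, by simp [tailVars], rfl⟩)

/-- Multiples of the killed variables lie in `C`. [folklore] -/
private theorem remC3_killed (b2 b3 b5 b6 b7 : MvPolynomial (Fin (2 * 3 + 2)) K) :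
    X 2 * b2 + X 3 * b3 + X 5 * b5 + X 6 * b6 + X 7 * b7 ∈ (remC3 : Ideal (MvPolynomial (Fin (2 * 3 + 2)) K)) :=
  Ideal.add_mem _ (Ideal.add_mem _ (Ideal.add_mem _ (Ideal.add_mem _ (Ideal.mul_mem_right _ _ remC3_X2) (Ideal.mul_mem_right _ _ remC3_X3)) (Ideal.mul_mem_right _ _ remC3_X5)) (Ideal.mul_mem_right _ _ remC3_X6)) (Ideal.mul_mem_right _ _ remC3_X7)

/-- `x_0 x_0 ∈ C`. [folklore] -/
private theorem remC3_q0_0 : (X 0 * X 0 : MvPolynomial (Fin (2 * 3 + 2)) K) ∈ remC3 := by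
  have e : (X 0 * X 0 : MvPolynomial (Fin (2 * 3 + 2)) K) =
      remComb3 (0) (1) (1) (0) (0) (0) + (X 2 * (0) + X 3 * (-(X 0) - (X 1) + X 4 - (X 6)) + X 5 * (0) + X 6 * (-(X 1)) + X 7 * (0)) := by
    simp only [remComb3, map_one]; ring
  rw [e]
  exact Ideal.add_mem _ (remComb3_mem _ _ _ _ _ _) (remC3_killed _ _ _ _ _)

/-- `x_0 x_1 ∈ C`. [folklore] -/
private theorem remC3_q0_1 : (X 0 * X 1 : MvPolynomial (Fin (2 * 3 + 2)) K) ∈ remC3 := by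
  have e : (X 0 * X 1 : MvPolynomial (Fin (2 * 3 + 2)) K) =
      remComb3 (-1) (0) (0) (1) (0) (0) + (X 2 * (0) + X 3 * (X 4 + X 6) + X 5 * (0) + X 6 * (X 0) + X 7 * (0)) := by
    simp only [remComb3, map_one]; ring
  rw [e]
  exact Ideal.add_mem _ (remComb3_mem _ _ _ _ _ _) (remC3_killed _ _ _ _ _)

/-- `x_0 x_4 ∈ C`. [folklore] -/
private theorem remC3_q0_4 : (X 0 * X 4 : MvPolynomial (Fin (2 * 3 + 2)) K) ∈ remC3 := by
  have e : (X 0 * X 4 : MvPolynomial (Fin (2 * 3 + 2)) K) =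
      remComb3 (0) (1) (0) (0) (0) (0) + (X 2 * (0) + X 3 * (-(X 6)) + X 5 * (0) + X 6 * (-(X 1)) + X 7 * (0)) := by
    simp only [remComb3, map_one]; ring
  rw [e]
  exact Ideal.add_mem _ (remComb3_mem _ _ _ _ _ _) (remC3_killed _ _ _ _ _)

/-- `x_1 x_1 ∈ C`. [folklore] -/
private theorem remC3_q1_1 : (X 1 * X 1 : MvPolynomial (Fin (2 * 3 + 2)) K) ∈ remC3 := by
  have e : (X 1 * X 1 : MvPolynomial (Fin (2 * 3 + 2)) K) =
      remComb3 (0) (-1) (-1) (0) (1) (0) + (X 2 * (0) + X 3 * (-(X 4) + X 6) + X 5 * (0) + X 6 * (X 1) + X 7 * (0)) := by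
    simp only [remComb3, map_one]; ring
  rw [e]
  exact Ideal.add_mem _ (remComb3_mem _ _ _ _ _ _) (remC3_killed _ _ _ _ _)

/-- `x_1 x_4 ∈ C`. [folklore] -/
private theorem remC3_q1_4 : (X 1 * X 4 : MvPolynomial (Fin (2 * 3 + 2)) K) ∈ remC3 := by
  have e : (X 1 * X 4 : MvPolynomial (Fin (2 * 3 + 2)) K) =
      remComb3 (0) (0) (0) (1) (0) (0) + (X 2 * (0) + X 3 * (X 6) + X 5 * (0) + X 6 * (X 0) + X 7 * (0)) := by
    simp only [remComb3, map_one]; ring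
  rw [e]
  exact Ideal.add_mem _ (remComb3_mem _ _ _ _ _ _) (remC3_killed _ _ _ _ _)

/-- `x_4 x_4 ∈ C`. [folklore] -/
private theorem remC3_q4_4 : (X 4 * X 4 : MvPolynomial (Fin (2 * 3 + 2)) K) ∈ remC3 := by
  have e : (X 4 * X 4 : MvPolynomial (Fin (2 * 3 + 2)) K) =
      remComb3 (0) (1) (0) (0) (0) (-1) + (X 2 * (0) + X 3 * (0) + X 5 * (0) + X 6 * (-(X 1)) + X 7 * (0)) := by
    simp only [remComb3, map_one]; ring
  rw [e]
  exact Ideal.add_mem _ (remComb3_mem _ _ _ _ _ _) (remC3_killed _ _ _ _ _)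

/-- The killed variables lie in `C`. [folklore] -/
private theorem remC3_kill : ∀ v ∈ ({2, 3, 5, 6, 7} : Finset (Fin (2 * 3 + 2))), (X v : MvPolynomial (Fin (2 * 3 + 2)) K) ∈ remC3 := by
  intro v hv
  simp only [Finset.mem_insert, Finset.mem_singleton] at hv
  rcases hv with rfl | rfl | rfl | rfl | rfl
  exacts [remC3_X2, remC3_X3, remC3_X5, remC3_X6, remC3_X7]

/-- All products of two variables lie in `C`. [folklore] -/
private theorem remC3_X_mul_X (i j : Fin (2 * 3 + 2)) : (X i * X j : MvPolynomial (Fin (2 * 3 + 2)) K) ∈ remC3 :=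
  forall_X_mul_X_mem ({2, 3, 5, 6, 7} : Finset (Fin (2 * 3 + 2))) remC3_kill 0 1 4 (by decide)
    remC3_q0_0 remC3_q0_1 remC3_q0_4 remC3_q1_1 remC3_q1_4 remC3_q4_4 i j

/-- **(H), degree 1**: `H(S/C)(1) ≤ 3`. [folklore] -/
private theorem remC3_h₁ :
    finrank K (homogeneousSubmodule (Fin (2 * 3 + 2)) K 1) - finrank K (idealDegree (remC3 (K := K)) 1) ≤ 3 := by
  have h := hilbert_one_le_of_X_mem (J := remC3 (K := K)) (![2, 3, 5, 6, 7] : Fin 5 → Fin (2 * 3 + 2)) (by decide)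
    (fun i => remC3_kill _ (by fin_cases i <;> simp))
  omega

/-- **(H), degree 2**: every quadric lies in `C`. [folklore] -/
private theorem remC3_h₂ (f : MvPolynomial (Fin (2 * 3 + 2)) K) (hf : f.IsHomogeneous 2) : f ∈ remC3 :=
  mem_of_forall_X_mul_X_mem remC3_X_mul_X f hf

open Literature.AlgebraicGeometry.Kloosterman2023 in
/-- **Remark 6.7 for `k = 3`, an unconditional rational instance**: for `L₀₅ = X 0 + X 3`, `L₁₅ = X 1 + X 3`, `L₂₃ = X 6`,
`L₂₄ = X 0 - (X 4)`, `t = 1` in `ℙ^7`, the ideal of `2 × 2` minors of `A_t` plus the tail has Hilbert function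
`χ_4(m) + 3χ_4(m−1)` — Hilbert series `(1 + 3s)/(1 − s)^4`, a `3`-dimensional linear section of the cone over the
quartic scroll: the reduction hypothesis of `remark_6_7_hilbert_fibre_of_reduction` is checked with
`y = (x_2, x_3, x_5, x_6)` by six quadratic identities. [cite: Kloosterman2025, Remark 6.7] -/
theorem remark_6_7_hilbert_fibre_instance_k3 (m : ℕ) :
    𝓗r_3(scrollFibreIdeal (tailVars 3 (3 + 4)) ⟨0, by omega⟩ ⟨1, by omega⟩ ⟨3, by omega⟩ ⟨4, by omega⟩
        (X 0 + X 3) (X 1 + X 3) (X 6) (X 0 - (X 4)) (1 : K), m) = chi 4 m + 3 * chi 4 ((m : ℤ) - 1) := by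
  have hL := scrollSubst_isHomogeneous (n := 2 * 3 + 1) ⟨0, by omega⟩ ⟨1, by omega⟩ ⟨3, by omega⟩ ⟨4, by omega⟩
    (1 : K) ((isHomogeneous_X K 0).add (isHomogeneous_X K 3)) ((isHomogeneous_X K 1).add (isHomogeneous_X K 3)) (isHomogeneous_X K 6) ((isHomogeneous_X K 0).sub (isHomogeneous_X K 4))
  have h1 := remC3_h₁ (K := K)
  have h2 := remC3_h₂ (K := K)
  have h := remark_6_7_hilbert_fibre_of_reduction (K := K) (k := 3) (by norm_num) (X 0 + X 3) (X 1 + X 3) (X 6) (X 0 - (X 4)) 1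
    hL remY3 (fun _ => isHomogeneous_X K _) h1 h2 m
  exact h


/-- **The Artinian reduction `(H)` holds at the `k = 3` instance of Remark 6.7**: for the instance forms and
`y = (x2, x3, x5, x6)`, the ideal `C = I_t + (x_T) + (y)` has `H(S/C)(1) ≤ 3` and contains every quadric — the
hypotheses `h₁, h₂` of `remark_6_7_hilbert_fibre_of_reduction`, exported for the general-fibre theorem.
[cite: Kloosterman2025, Remark 6.7] -/
theorem remark_6_7_reduction_instance_k3 :
    (finrank K (homogeneousSubmodule (Fin (2 * 3 + 2)) K 1) - finrank K (idealDegree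
      (scrollFibreIdeal (tailVars 3 (3 + 4)) ⟨0, by omega⟩ ⟨1, by omega⟩ ⟨3, by omega⟩ ⟨4, by omega⟩
          (X 0 + X 3) (X 1 + X 3) (X 6) (X 0 - (X 4)) (1 : K) ⊔
        Ideal.span (Set.range fun j : Fin (3 + 1) => (X (![2, 3, 5, 6] j) : MvPolynomial (Fin (2 * 3 + 2)) K))) 1) ≤ 3) ∧
    (∀ f : MvPolynomial (Fin (2 * 3 + 2)) K, f.IsHomogeneous 2 → f ∈
      scrollFibreIdeal (tailVars 3 (3 + 4)) ⟨0, by omega⟩ ⟨1, by omega⟩ ⟨3, by omega⟩ ⟨4, by omega⟩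
          (X 0 + X 3) (X 1 + X 3) (X 6) (X 0 - (X 4)) (1 : K) ⊔
        Ideal.span (Set.range fun j : Fin (3 + 1) => (X (![2, 3, 5, 6] j) : MvPolynomial (Fin (2 * 3 + 2)) K))) :=
  ⟨remC3_h₁, remC3_h₂⟩

end Rem67Instance3

end Literature.AlgebraicGeometry.Kloosterman2025
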